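import Literature.NumberTheory.LFunctions.SelbergSigmaXT
import Literature.NumberTheory.LFunctions.ZetaArgVariation
import HarnessLib

/-!
# Selberg's approximate formula for `S(t)`, pointwise and unconditional (Titchmarsh Thm. 14.21 without RH)

Topic `Literature/NumberTheory/LFunctions`. Everything in this file is PROVED (no definitions
beyond abbreviations, no named facts).

With `x = e^ℓ`, Selberg's weights `Λ_x` (`SelbergExplicit.smoothing`), Selberg's abscissa
`σ_{x,t} = ½ + δ₁(t)` (`SelbergSigma.delta`) and `s₁ = σ_{x,t} + it`, this file proves the
unconditional form of Titchmarsh's Theorem 14.21 (A. Selberg, *Contributions to the theory of the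
Riemann zeta-function* (1946), Thm. 1 in spirit; Titchmarsh proves it on RH with
`σ₁ = ½ + 1/log x`):

  `|π S(t) + Im Σ_{n<x³} Λ_x(n) n^{−σ_{x,t}−it}/log n| ≤ C δ₁(t) (‖Σ_{n<x³} Λ_x(n) n^{−s₁}‖ + log t)`

for `t` not the ordinate of a zero, `8 ≤ ℓ ≤ 2 log t` (`selberg_approx_pointwise`). The proof is
Titchmarsh's §14.21 verbatim with the RH inputs replaced by `SelbergSigmaXT.lean`:
`π S(t) = −∫_{½}^{∞} Im ζ'/ζ(σ+it) dσ` (`pi_mul_zetaArgS_eq_neg_integral_Ioi`) is split as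
`J₁ + J₂ + J₃`; on `σ ≥ σ_{x,t}` the explicit formula (`SelbergExplicit.explicit_formula`, and
`SelbergExplicit.norm_logDeriv_add_fordK_le` beyond `σ = 3/2`) with
`‖Σ_ρ …‖ ≤ ε(u)e^{−(σ−σ_{x,t})ℓ}W` and `W ≤ 6‖D(s₁)‖ + C log t`; on `½ ≤ σ ≤ σ_{x,t}` the
Hadamard partial fraction for `ζ'/ζ(s₁) − ζ'/ζ(s)` (`hasSum_zeroOrder_mul_inv_sub_sub`, the
complex companion of the tree's `hasSum_zeroOrder_mul_re_inv_sub`).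

## References

* E. C. Titchmarsh, *The Theory of the Riemann Zeta-Function*, 2nd ed. (1986), §14.21
  (pp. 346–347 of the held copy). [cite: Titchmarsh1986, Thm. 14.21]
* A. Selberg, Arch. Math. Naturvid. 48 (1946) no. 5, §4.
* D. A. Goldston, *Notes on pair correlation of zeros and prime numbers* (2005), §10,
  (10.8)–(10.18).
-/

noncomputable section

open Complex Real MeasureTheory Set Filter Topology intervalIntegral
open scoped ComplexConjugate

namespace Literature.NumberTheory.LFunctions

/-! ## The Hadamard partial fraction for a difference `ξ'/ξ(s₁) − ξ'/ξ(s)` -/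

/-- `Σ_ρ m(ρ) ‖1/(s₁−ρ) − 1/(s−ρ)‖ < ∞` at any two points which are not zeros. [folklore] -/
theorem summable_norm_zeroOrder_mul_inv_sub_sub {s₁ s : ℂ} (h₁ : riemannZeta s₁ ≠ 0)
    (h : riemannZeta s ≠ 0) :
    Summable fun ρ : RHWave0.riemannZetaNontrivialZeros ↦
      ‖(riemannZetaZeroOrder (ρ : ℂ) : ℂ) * (1 / (s₁ - ρ) - 1 / (s - ρ))‖ := by
  -- `‖1/(s₁−ρ) − 1/(s−ρ)‖ ≤ ‖s − s₁‖ (1/‖s₁−ρ‖² + 1/‖s−ρ‖²)/2`, each summable against `m`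
  have key : ∀ z : ℂ, riemannZeta z ≠ 0 → Summable fun ρ : RHWave0.riemannZetaNontrivialZeros ↦
      (riemannZetaZeroOrder (ρ : ℂ) : ℝ) * (1 / ‖z - ρ‖ ^ 2) := by
    intro z hz
    obtain ⟨d, hd0, hd1, hd⟩ := SmoothedEF.exists_dist_zeros_ge hz
    set C : ℝ := (1 + 2 * z.im ^ 2) / d ^ 2 + 2 with hC
    refine Summable.of_nonneg_of_le (fun ρ ↦ mul_nonneg (ZetaZeroSum.zeroOrder_nonneg ρ) (by positivity))
      (fun ρ ↦ ?_) (ZetaZeroSum.summable_zeroOrder_div_one_add_sq.mul_left C)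
    have hm := ZetaZeroSum.zeroOrder_nonneg ρ
    have hρ := ρ.2
    have hdρ := hd _ hρ
    have hpos : 0 < ‖z - (ρ : ℂ)‖ := hd0.trans_le hdρ
    have hn2 : (z.im - (ρ : ℂ).im) ^ 2 ≤ ‖z - ρ‖ ^ 2 := by
      have := Complex.abs_im_le_norm (z - ρ)
      rw [sub_im] at this
      nlinarith [abs_nonneg (z.im - (ρ : ℂ).im), sq_abs (z.im - (ρ : ℂ).im)]
    have hd2 : d ^ 2 ≤ ‖z - ρ‖ ^ 2 := by nlinarith [norm_nonneg (z - (ρ : ℂ))]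
    have hkey : 1 + (ρ : ℂ).im ^ 2 ≤ C * ‖z - ρ‖ ^ 2 := by
      have e1 : (ρ : ℂ).im ^ 2 ≤ 2 * (z.im - (ρ : ℂ).im) ^ 2 + 2 * z.im ^ 2 := by
        nlinarith [sq_nonneg (2 * z.im - (ρ : ℂ).im)]
      have e2 : 1 + 2 * z.im ^ 2 ≤ (1 + 2 * z.im ^ 2) / d ^ 2 * ‖z - ρ‖ ^ 2 := by
        rw [div_mul_eq_mul_div, le_div_iff₀ (by positivity)]
        exact mul_le_mul_of_nonneg_left hd2 (by positivity)
      calc 1 + (ρ : ℂ).im ^ 2 ≤ (1 + 2 * z.im ^ 2) + 2 * (z.im - (ρ : ℂ).im) ^ 2 := by linarith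
        _ ≤ (1 + 2 * z.im ^ 2) / d ^ 2 * ‖z - ρ‖ ^ 2 + 2 * ‖z - ρ‖ ^ 2 := by linarith
        _ = C * ‖z - ρ‖ ^ 2 := by rw [hC]; ring
    calc (riemannZetaZeroOrder (ρ : ℂ) : ℝ) * (1 / ‖z - ρ‖ ^ 2)
        ≤ (riemannZetaZeroOrder (ρ : ℂ) : ℝ) * (C / (1 + (ρ : ℂ).im ^ 2)) := by
          refine mul_le_mul_of_nonneg_left ?_ hm
          rw [div_le_div_iff₀ (by positivity) (by positivity), one_mul]
          exact hkey
      _ = C * ((riemannZetaZeroOrder (ρ : ℂ) : ℝ) / (1 + (ρ : ℂ).im ^ 2)) := by ring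
  have hsum := ((key s₁ h₁).add (key s h)).mul_left (‖s - s₁‖ / 2)
  refine Summable.of_nonneg_of_le (fun _ ↦ norm_nonneg _) (fun ρ ↦ ?_) hsum
  have hm := ZetaZeroSum.zeroOrder_nonneg ρ
  have hρζ : riemannZeta ρ = 0 := ZetaZeros.riemannZetaNontrivialZeros.zeta_eq_zero ρ.2
  have hne1 : s₁ - (ρ : ℂ) ≠ 0 := sub_ne_zero.2 fun e ↦ h₁ (e ▸ hρζ)
  have hne : s - (ρ : ℂ) ≠ 0 := sub_ne_zero.2 fun e ↦ h (e ▸ hρζ)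
  have hid : 1 / (s₁ - (ρ : ℂ)) - 1 / (s - ρ) = (s - s₁) / ((s₁ - ρ) * (s - ρ)) := by
    field_simp; ring
  rw [norm_mul, Complex.norm_intCast, abs_of_nonneg hm, hid, norm_div, norm_mul]
  have hp1 : 0 < ‖s₁ - (ρ : ℂ)‖ := norm_pos_iff.2 hne1
  have hp : 0 < ‖s - (ρ : ℂ)‖ := norm_pos_iff.2 hne
  have hamgm : 1 / (‖s₁ - (ρ : ℂ)‖ * ‖s - ρ‖) ≤ (1 / ‖s₁ - (ρ : ℂ)‖ ^ 2 + 1 / ‖s - (ρ : ℂ)‖ ^ 2) / 2 := by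
    rw [div_add_div _ _ (by positivity) (by positivity), div_div,
      div_le_div_iff₀ (by positivity) (by positivity)]
    nlinarith [sq_nonneg (‖s₁ - (ρ : ℂ)‖ - ‖s - (ρ : ℂ)‖), mul_pos hp1 hp]
  calc (riemannZetaZeroOrder (ρ : ℂ) : ℝ) * (‖s - s₁‖ / (‖s₁ - (ρ : ℂ)‖ * ‖s - ρ‖))
      = (riemannZetaZeroOrder (ρ : ℂ) : ℝ) * ‖s - s₁‖ * (1 / (‖s₁ - (ρ : ℂ)‖ * ‖s - ρ‖)) := by ring
    _ ≤ (riemannZetaZeroOrder (ρ : ℂ) : ℝ) * ‖s - s₁‖ *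
          ((1 / ‖s₁ - (ρ : ℂ)‖ ^ 2 + 1 / ‖s - (ρ : ℂ)‖ ^ 2) / 2) :=
        mul_le_mul_of_nonneg_left hamgm (by positivity)
    _ = ‖s - s₁‖ / 2 * ((riemannZetaZeroOrder (ρ : ℂ) : ℝ) * (1 / ‖s₁ - (ρ : ℂ)‖ ^ 2) +
          (riemannZetaZeroOrder (ρ : ℂ) : ℝ) * (1 / ‖s - (ρ : ℂ)‖ ^ 2)) := by ring

/-- **`Σ_ρ m(ρ) [1/(s₁−ρ) − 1/(s−ρ)] = ξ'/ξ(s₁) − ξ'/ξ(s)`** over the non-trivial zeros of `ζ`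
with multiplicity, at any two points `s₁, s` which are not zeros (the termwise difference of the
Hadamard partial fractions `ξ'/ξ(s) = Σ_k [1/(s−ρ_k) + 1/(s−(1−ρ_k))]` over a Hadamard sequence,
with the multiplicity bookkeeping of `hasSum_zeroOrder_mul_re_inv_sub`). The difference converges
absolutely without pairing. [folklore] -/
theorem hasSum_zeroOrder_mul_inv_sub_sub {s₁ s : ℂ} (h₁ : riemannZeta s₁ ≠ 0)
    (h : riemannZeta s ≠ 0) :
    HasSum (fun ρ : RHWave0.riemannZetaNontrivialZeros ↦
      (riemannZetaZeroOrder (ρ : ℂ) : ℂ) * (1 / (s₁ - ρ) - 1 / (s - ρ)))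
      (logDeriv riemannXi s₁ - logDeriv riemannXi s) := by
  classical
  have hξ₁ : riemannXi s₁ ≠ 0 := fun e ↦ h₁ ((riemannXi_eq_zero_iff_holds s₁).1 e).1
  have hξ : riemannXi s ≠ 0 := fun e ↦ h ((riemannXi_eq_zero_iff_holds s).1 e).1
  obtain ⟨b, hb⟩ := exists_isHadamardSeq 0
  set F : ℂ → ℂ := fun ρ ↦ 1 / (s₁ - ρ) - 1 / (s - ρ) with hF
  set G : ℕ → ℂ := fun k ↦ if b k = 0 then 0 else
    (F (IsHadamardSeq.xiZero b k) + F (1 - IsHadamardSeq.xiZero b k)) with hG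
  have hP₁ := (hb.summable_pairs hξ₁).hasSum
  have hP := (hb.summable_pairs hξ).hasSum
  rw [← hb.logDeriv_riemannXi_eq_tsum_pairs hξ₁] at hP₁
  rw [← hb.logDeriv_riemannXi_eq_tsum_pairs hξ] at hP
  have hGsum : HasSum G (logDeriv riemannXi s₁ - logDeriv riemannXi s) := by
    refine (hP₁.sub hP).congr_fun fun n ↦ ?_
    simp only [hG, hF]
    split_ifs <;> ring
  have hG0 : ∀ k, b k = 0 → G k = 0 := fun k hk ↦ by simp [hG, hk]
  set K : ℝ → Finset ℕ := fun T ↦ (hb.finite_setOf_abs_im_xiZero_le T).toFinset with hK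
  have hKmem : ∀ T k, k ∈ K T ↔ b k ≠ 0 ∧ |(IsHadamardSeq.xiZero b k).im| ≤ T := fun T k ↦ by
    rw [hK, Set.Finite.mem_toFinset]; rfl
  have hlim1 : Tendsto (fun T ↦ ∑ k ∈ K T, G k) atTop (𝓝 (logDeriv riemannXi s₁ - logDeriv riemannXi s)) :=
    IsHadamardSeq.tendsto_sum_truncation hGsum hG0 K hKmem
  have hbox : ∀ T, ∑ ρ ∈ weilZeroFinset T, (riemannZetaZeroOrder (ρ : ℂ) : ℂ) * F ρ = ∑ k ∈ K T, G k := by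
    intro T
    rw [← ZetaZeroSum.finsum_mem_weilZeroIndex_eq_sum (fun ρ ↦ (riemannZetaZeroOrder ρ : ℂ) * F ρ) T,
      ← liZeroBox_eq_weilZeroIndex, hb.finsum_liZeroBox_eq_sum F T (K T) (hKmem T)]
    refine Finset.sum_congr rfl fun k hk ↦ ?_
    simp [hG, ((hKmem T k).1 hk).1]
  have hsumC : Summable fun ρ : RHWave0.riemannZetaNontrivialZeros ↦
      (riemannZetaZeroOrder (ρ : ℂ) : ℂ) * F ρ := (summable_norm_zeroOrder_mul_inv_sub_sub h₁ h).of_norm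
  have hlim2 : Tendsto (fun T ↦ ∑ ρ ∈ weilZeroFinset T, (riemannZetaZeroOrder (ρ : ℂ) : ℂ) * F ρ)
      atTop (𝓝 (∑' ρ : RHWave0.riemannZetaNontrivialZeros, (riemannZetaZeroOrder (ρ : ℂ) : ℂ) * F ρ)) :=
    hsumC.hasSum.comp tendsto_weilZeroFinset
  have heq : (∑' ρ : RHWave0.riemannZetaNontrivialZeros, (riemannZetaZeroOrder (ρ : ℂ) : ℂ) * F ρ) =
      logDeriv riemannXi s₁ - logDeriv riemannXi s :=
    tendsto_nhds_unique hlim2 (hlim1.congr fun T ↦ (hbox T).symm)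
  rw [← heq]
  exact hsumC.hasSum

namespace SelbergApprox

/-! ## Integrating the Dirichlet polynomial `D(s) = Σ Λ_x(n) n^{−s}` along `σ ≥ σ₁` -/

/-- `n^{−(σ+it)} = e^{−it log n} e^{−σ log n}` as a function of `σ` (`n ≥ 1`). [folklore] -/
theorem natCast_cpow_neg_eq (n : ℕ) (hn : 0 < n) (σ t : ℝ) :
    (n : ℂ) ^ (-((σ : ℂ) + t * I)) =
      Complex.exp (-(t * Real.log n) * I) * Complex.exp ((-(Real.log n : ℂ)) * σ) := by
  have hn0 : (n : ℂ) ≠ 0 := by exact_mod_cast hn.ne'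
  rw [Complex.cpow_def_of_ne_zero hn0, ← Complex.exp_add, Complex.natCast_log]
  congr 1
  ring

/-- **`∫_{a}^{∞} n^{−σ−it} dσ = n^{−a−it}/log n`** for `n ≥ 2`. [folklore] -/
theorem integral_Ioi_natCast_cpow_neg {n : ℕ} (hn : 2 ≤ n) (a t : ℝ) :
    ∫ σ in Ioi a, (n : ℂ) ^ (-((σ : ℂ) + t * I)) = (n : ℂ) ^ (-((a : ℂ) + t * I)) / (Real.log n : ℂ) := by
  have hn0 : 0 < n := by omega
  have hlog : 0 < Real.log n := Real.log_pos (by exact_mod_cast hn)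
  have hre : (-(Real.log n : ℂ)).re < 0 := by rw [Complex.neg_re, Complex.ofReal_re]; linarith
  simp_rw [natCast_cpow_neg_eq n hn0]
  rw [MeasureTheory.integral_const_mul, integral_exp_mul_complex_Ioi hre a]
  have hl0 : (Real.log n : ℂ) ≠ 0 := Complex.ofReal_ne_zero.2 hlog.ne'
  field_simp

/-- `σ ↦ n^{−σ−it}` is integrable on `(a, ∞)` for `n ≥ 2`. [folklore] -/
theorem integrableOn_natCast_cpow_neg {n : ℕ} (hn : 2 ≤ n) (a t : ℝ) :
    IntegrableOn (fun σ : ℝ ↦ (n : ℂ) ^ (-((σ : ℂ) + t * I))) (Ioi a) := by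
  have hn0 : 0 < n := by omega
  have hlog : 0 < Real.log n := Real.log_pos (by exact_mod_cast hn)
  have hre : (-(Real.log n : ℂ)).re < 0 := by rw [Complex.neg_re, Complex.ofReal_re]; linarith
  have h : IntegrableOn (fun σ : ℝ ↦ Complex.exp (-(t * Real.log n) * I) *
      Complex.exp ((-(Real.log n : ℂ)) * σ)) (Ioi a) :=
    (integrableOn_exp_mul_complex_Ioi hre a).const_mul (Complex.exp (-(t * Real.log n) * I))
  refine h.congr_fun (fun σ _ ↦ ?_) measurableSet_Ioi
  exact (natCast_cpow_neg_eq n hn0 σ t).symm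

/-- The Dirichlet polynomial `D(σ + it) = Σ_{n<N} Λ(n) f_ℓ(log n) n^{−σ−it}` written termwise (the
terms `n = 0, 1` vanish as `Λ(0) = Λ(1) = 0`). [folklore] -/
theorem fordK_smoothing_eq_sum_two {ℓ : ℝ} (hℓ : 0 ≤ ℓ) {N : ℕ} (hN : 2 ≤ N) (hx : 3 * ℓ ≤ Real.log N)
    (s : ℂ) :
    fordK (SelbergExplicit.smoothing ℓ) s = ∑ n ∈ Finset.Ico 2 N,
      ((ArithmeticFunction.vonMangoldt n : ℝ) : ℂ) * (SelbergExplicit.smoothing ℓ (Real.log n) : ℂ) *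
        (n : ℂ) ^ (-s) := by
  rw [SelbergExplicit.fordK_smoothing_eq_sum hℓ (by omega) hx s, Finset.range_eq_Ico]
  rw [← Finset.sum_Ico_consecutive _ (show 0 ≤ 2 by norm_num) hN]
  have h0 : ∑ n ∈ Finset.Ico 0 2, ((ArithmeticFunction.vonMangoldt n : ℝ) : ℂ) *
      (SelbergExplicit.smoothing ℓ (Real.log n) : ℂ) * (n : ℂ) ^ (-s) = 0 := by
    rw [show Finset.Ico 0 2 = {0, 1} by decide, Finset.sum_pair (by norm_num)]
    simp [ArithmeticFunction.vonMangoldt_apply_one]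
  rw [h0, zero_add]

/-- **`∫_{a}^{∞} D(σ+it) dσ = Σ_{2 ≤ n < N} Λ(n) f_ℓ(log n) n^{−a−it}/log n`** and `D(· + it)` is
integrable on `(a, ∞)`. [cite: Titchmarsh1986, §14.21 (J₁)] -/
theorem integral_Ioi_fordK {ℓ : ℝ} (hℓ : 0 ≤ ℓ) {N : ℕ} (hN : 2 ≤ N) (hx : 3 * ℓ ≤ Real.log N)
    (a t : ℝ) :
    IntegrableOn (fun σ : ℝ ↦ fordK (SelbergExplicit.smoothing ℓ) (σ + t * I)) (Ioi a) ∧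
    ∫ σ in Ioi a, fordK (SelbergExplicit.smoothing ℓ) (σ + t * I) = ∑ n ∈ Finset.Ico 2 N,
      ((ArithmeticFunction.vonMangoldt n : ℝ) : ℂ) * (SelbergExplicit.smoothing ℓ (Real.log n) : ℂ) *
        ((n : ℂ) ^ (-((a : ℂ) + t * I)) / (Real.log n : ℂ)) := by
  have heq : (fun σ : ℝ ↦ fordK (SelbergExplicit.smoothing ℓ) (σ + t * I)) = fun σ : ℝ ↦
      ∑ n ∈ Finset.Ico 2 N, ((ArithmeticFunction.vonMangoldt n : ℝ) : ℂ) *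
        (SelbergExplicit.smoothing ℓ (Real.log n) : ℂ) * (n : ℂ) ^ (-((σ : ℂ) + t * I)) := by
    funext σ; exact fordK_smoothing_eq_sum_two hℓ hN hx _
  have hint : ∀ n ∈ Finset.Ico 2 N, IntegrableOn (fun σ : ℝ ↦
      ((ArithmeticFunction.vonMangoldt n : ℝ) : ℂ) * (SelbergExplicit.smoothing ℓ (Real.log n) : ℂ) *
        (n : ℂ) ^ (-((σ : ℂ) + t * I))) (Ioi a) := fun n hn ↦
    (integrableOn_natCast_cpow_neg (Finset.mem_Ico.1 hn).1 a t).const_mul _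
  rw [heq]
  refine ⟨integrable_finsetSum _ hint, ?_⟩
  rw [integral_finsetSum _ hint]
  refine Finset.sum_congr rfl fun n hn ↦ ?_
  rw [MeasureTheory.integral_const_mul, integral_Ioi_natCast_cpow_neg (Finset.mem_Ico.1 hn).1]

/-! ## The remainder `R(σ) = ζ'/ζ(σ+it) + D(σ+it)` to the right of `σ_{x,t}` -/

/-- **`ζ'/ζ + D` on `σ_{x,t} < σ < 3/2`**: explicit formula, Lemma Z and (14.21.3):
`‖ζ'/ζ(σ+it) + D(σ+it)‖ ≤ 4/ℓ² + (3/10) e^{−(σ−σ_{x,t})ℓ} W(t) + ‖J_x(σ+it)‖`.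
[cite: Titchmarsh1986, (14.21.4)] -/
theorem norm_logDeriv_add_fordK_le_of_lt {ℓ t σ : ℝ} (hℓ : 8 ≤ ℓ) (ht : 1 ≤ t)
    (hℓt : ℓ ≤ 2 * Real.log t) (hσ₁ : 1 / 2 + SelbergSigma.delta ℓ t ≤ σ) (hσ₂ : σ < 3 / 2) :
    ‖deriv riemannZeta (σ + t * I) / riemannZeta (σ + t * I) + fordK (SelbergExplicit.smoothing ℓ) (σ + t * I)‖ ≤
      4 / ℓ ^ 2 + 3 / 10 * Real.exp (-((σ - 1 / 2 - SelbergSigma.delta ℓ t) * ℓ)) * SelbergSigma.W ℓ t +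
        ‖SelbergExplicit.remainder ℓ (σ + t * I)‖ := by
  have hℓ0 : 0 < ℓ := by linarith
  have hℓ1 : 1 ≤ ℓ := by linarith
  set δ := SelbergSigma.delta ℓ t with hδ
  have hδ0 : 0 < δ := SelbergSigma.delta_pos hℓ0 t
  have hu : 4 ≤ δ * ℓ := by
    have := SelbergSigma.four_div_le_delta ℓ t; rw [← hδ, div_le_iff₀ hℓ0] at this; linarith
  set s : ℂ := σ + t * I with hs
  have hsre : s.re = σ := by simp [hs]
  have hsim : s.im = t := by simp [hs]
  have hζ : riemannZeta s ≠ 0 := SelbergSigma.riemannZeta_ne_zero_of_lt hℓ0 (by rw [← hδ]; linarith)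
  have hs1 : s ≠ 1 := fun h ↦ by
    have := congrArg Complex.im h; rw [hsim, Complex.one_im] at this; linarith
  have hEF := SelbergExplicit.explicit_formula hℓ0 (s := s) (by rw [hsre]; linarith) (by rw [hsre]; linarith) hs1 hζ
  -- the pole term
  have hT1 : ‖SelbergExplicit.zeroTerm ℓ s 1‖ ≤ 4 / ℓ ^ 2 := by
    have h := SelbergSigma.norm_zeroTerm_one_le (ℓ := ℓ) (t := t) (δ := σ - 1 / 2) hℓ0 ht hℓt (by linarith)
    have e : (((1 / 2 + (σ - 1 / 2) : ℝ)) : ℂ) + t * I = s := by rw [hs]; congr 1; push_cast; ring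
    rwa [e] at h
  -- the zero sum
  have hZ := SelbergSigma.norm_tsum_zeroTerm_le (ℓ := ℓ) (t := t) (σ := σ) hℓ1 (by rw [← hδ]; linarith)
  rw [← hδ] at hZ
  have heps := SelbergSigma.eps_le hu
  have hW0 := SelbergSigma.W_nonneg ℓ t hℓ0
  have hE0 := (Real.exp_pos (-((σ - 1 / 2 - δ) * ℓ))).le
  have hZ' : ‖∑' ρ : RHWave0.riemannZetaNontrivialZeros,
      (riemannZetaZeroOrder (ρ : ℂ) : ℂ) * SelbergExplicit.zeroTerm ℓ s ρ‖ ≤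
      3 / 10 * Real.exp (-((σ - 1 / 2 - δ) * ℓ)) * SelbergSigma.W ℓ t := by
    refine hZ.trans ?_
    gcongr
  have hid : deriv riemannZeta s / riemannZeta s + fordK (SelbergExplicit.smoothing ℓ) s =
      -SelbergExplicit.zeroTerm ℓ s 1 +
        ∑' ρ : RHWave0.riemannZetaNontrivialZeros, (riemannZetaZeroOrder (ρ : ℂ) : ℂ) * SelbergExplicit.zeroTerm ℓ s ρ +
        SelbergExplicit.remainder ℓ s := by
    rw [hEF]; ring
  rw [hid]
  have e1 := norm_add_le (-SelbergExplicit.zeroTerm ℓ s 1 +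
    ∑' ρ : RHWave0.riemannZetaNontrivialZeros, (riemannZetaZeroOrder (ρ : ℂ) : ℂ) * SelbergExplicit.zeroTerm ℓ s ρ)
    (SelbergExplicit.remainder ℓ s)
  have e2 := norm_add_le (-SelbergExplicit.zeroTerm ℓ s 1)
    (∑' ρ : RHWave0.riemannZetaNontrivialZeros, (riemannZetaZeroOrder (ρ : ℂ) : ℂ) * SelbergExplicit.zeroTerm ℓ s ρ)
  rw [norm_neg] at e2
  linarith

/-- **The majorant of `R(σ)` on `σ > σ_{x,t}`.** With `CJ` the constant of
`SelbergExplicit.norm_remainder_le` and `B₀ = Σ Λ(n) n^{−5/4}`: for `σ_{x,t} < σ`,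
`‖ζ'/ζ(σ+it) + D(σ+it)‖ ≤ K e^{−(σ−σ_{x,t})} + (3/10) W e^{−(σ−σ_{x,t})ℓ}`,
`K = e(4/ℓ² + CJ(1 + log(1+|t|))e^{−ℓ}/ℓ² + B₀e^{−ℓ/4})`. [cite: Titchmarsh1986, §14.21 (J₁)] -/
theorem norm_logDeriv_add_fordK_le_majorant {ℓ t σ : ℝ} (hℓ : 8 ≤ ℓ) (ht : 1 ≤ t)
    (hℓt : ℓ ≤ 2 * Real.log t) (hσ₁ : 1 / 2 + SelbergSigma.delta ℓ t < σ) :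
    ‖deriv riemannZeta (σ + t * I) / riemannZeta (σ + t * I) + fordK (SelbergExplicit.smoothing ℓ) (σ + t * I)‖ ≤
      Real.exp 1 * (4 / ℓ ^ 2 + SelbergExplicit.norm_remainder_le.choose * (1 + Real.log (1 + |t|)) *
          Real.exp (-ℓ) / ℓ ^ 2 +
        (∑' n : ℕ, (ArithmeticFunction.vonMangoldt n : ℝ) * (n : ℝ) ^ (-(5 / 4 : ℝ))) * Real.exp (-(ℓ / 4))) *
        Real.exp (-(σ - 1 / 2 - SelbergSigma.delta ℓ t)) +
      3 / 10 * SelbergSigma.W ℓ t * Real.exp (-((σ - 1 / 2 - SelbergSigma.delta ℓ t) * ℓ)) := by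
  have hℓ0 : 0 < ℓ := by linarith
  have hℓ1 : 1 ≤ ℓ := by linarith
  set δ := SelbergSigma.delta ℓ t with hδ
  have hδ0 : 0 < δ := SelbergSigma.delta_pos hℓ0 t
  have hδ1 : δ < 1 := SelbergSigma.delta_lt_one (by linarith) t
  set CJ := SelbergExplicit.norm_remainder_le.choose with hCJ
  obtain ⟨hCJ0, hCJb⟩ := SelbergExplicit.norm_remainder_le.choose_spec
  set B₀ : ℝ := ∑' n : ℕ, (ArithmeticFunction.vonMangoldt n : ℝ) * (n : ℝ) ^ (-(5 / 4 : ℝ)) with hB₀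
  have hB₀0 : 0 ≤ B₀ := tsum_nonneg fun n ↦ mul_nonneg ArithmeticFunction.vonMangoldt_nonneg
    (Real.rpow_nonneg (Nat.cast_nonneg n) _)
  have hW0 := SelbergSigma.W_nonneg ℓ t hℓ0
  have hlog0 : 0 ≤ Real.log (1 + |t|) := Real.log_nonneg (by linarith [abs_nonneg t])
  set E : ℝ := Real.exp (-(σ - 1 / 2 - δ)) with hE
  have hE0 : 0 < E := Real.exp_pos _
  -- the three constants are nonnegative
  have hK1 : 0 ≤ 4 / ℓ ^ 2 := by positivity
  have hK2 : 0 ≤ CJ * (1 + Real.log (1 + |t|)) * Real.exp (-ℓ) / ℓ ^ 2 := by positivity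
  have hK3 : 0 ≤ B₀ * Real.exp (-(ℓ / 4)) := by positivity
  rcases lt_or_ge σ (3 / 2) with hσ₂ | hσ₂
  · -- explicit formula range
    have h := norm_logDeriv_add_fordK_le_of_lt hℓ ht hℓt hσ₁.le hσ₂
    rw [← hδ] at h
    refine h.trans ?_
    -- `1 ≤ e · E` since `σ − ½ − δ < 1`
    have heE : 1 ≤ Real.exp 1 * E := by
      rw [hE, ← Real.exp_add]; exact Real.one_le_exp (by linarith)
    have hJ : ‖SelbergExplicit.remainder ℓ (σ + t * I)‖ ≤
        CJ * (1 + Real.log (1 + |t|)) * Real.exp (-ℓ) / ℓ ^ 2 := by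
      have hb := hCJb ℓ hℓ0 (σ + t * I) (by simp; linarith)
      simp only [add_re, Complex.ofReal_re, mul_re, Complex.I_re, mul_zero, Complex.ofReal_im,
        Complex.I_im, mul_one, sub_self, add_zero, add_im, mul_im, zero_add] at hb
      refine hb.trans ?_
      have hX : 0 ≤ CJ * (1 + Real.log (1 + |t|)) := mul_nonneg hCJ0.le (by positivity)
      have hexp : Real.exp (-(ℓ * (σ + 1 / 2))) ≤ Real.exp (-ℓ) := Real.exp_le_exp.2 (by nlinarith)
      exact div_le_div_of_nonneg_right (mul_le_mul_of_nonneg_left hexp hX) (by positivity)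
    have e1 : 4 / ℓ ^ 2 ≤ Real.exp 1 * (4 / ℓ ^ 2) * E := by
      have := mul_le_mul_of_nonneg_left heE hK1; linarith [this]
    have e2 : CJ * (1 + Real.log (1 + |t|)) * Real.exp (-ℓ) / ℓ ^ 2 ≤
        Real.exp 1 * (CJ * (1 + Real.log (1 + |t|)) * Real.exp (-ℓ) / ℓ ^ 2) * E := by
      have := mul_le_mul_of_nonneg_left heE hK2; linarith [this]
    have e3 : 0 ≤ Real.exp 1 * (B₀ * Real.exp (-(ℓ / 4))) * E := by positivity
    nlinarith [hJ, e1, e2, e3, mul_nonneg (mul_nonneg (show (0:ℝ) ≤ 3 / 10 by norm_num) hW0)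
      (Real.exp_pos (-((σ - 1 / 2 - δ) * ℓ))).le]
  · -- beyond `3/2`: no explicit formula needed
    have h := SelbergExplicit.norm_logDeriv_add_fordK_le (s := σ + t * I) hℓ0 (σ₀ := 5 / 4)
      (by norm_num) (by simp; linarith)
    simp only [add_re, Complex.ofReal_re, mul_re, Complex.I_re, mul_zero, Complex.ofReal_im,
      Complex.I_im, mul_one, sub_self, add_zero] at h
    rw [← hB₀] at h
    refine h.trans ?_
    -- `e^{−ℓ(σ−5/4)} ≤ e · e^{−ℓ/4} · E`
    have hexp : Real.exp (-(ℓ * (σ - 5 / 4))) ≤ Real.exp 1 * Real.exp (-(ℓ / 4)) * E := by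
      rw [hE, ← Real.exp_add, ← Real.exp_add, Real.exp_le_exp]
      have h1 : σ - 3 / 2 ≤ ℓ * (σ - 3 / 2) := by nlinarith
      nlinarith [hδ0.le]
    have e1 : Real.exp (-(ℓ * (σ - 5 / 4))) * B₀ ≤ Real.exp 1 * (B₀ * Real.exp (-(ℓ / 4))) * E := by
      have := mul_le_mul_of_nonneg_right hexp hB₀0; linarith [this]
    have e2 : 0 ≤ Real.exp 1 * (4 / ℓ ^ 2) * E := by positivity
    have e3 : 0 ≤ Real.exp 1 * (CJ * (1 + Real.log (1 + |t|)) * Real.exp (-ℓ) / ℓ ^ 2) * E := by positivity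
    nlinarith [e1, e2, e3, mul_nonneg (mul_nonneg (show (0:ℝ) ≤ 3 / 10 by norm_num) hW0)
      (Real.exp_pos (-((σ - 1 / 2 - δ) * ℓ))).le]

/-- The majorant is integrable on `(σ_{x,t}, ∞)` with integral `K + (3/10) W/ℓ`:
`∫_{σ₁}^∞ e^{−(σ−σ₁)} dσ = 1`, `∫_{σ₁}^∞ e^{−(σ−σ₁)ℓ} dσ = 1/ℓ`. [folklore] -/
theorem integral_majorant {ℓ : ℝ} (hℓ : 0 < ℓ) (σ₁ K L : ℝ) :
    IntegrableOn (fun σ : ℝ ↦ K * Real.exp (-(σ - σ₁)) + L * Real.exp (-((σ - σ₁) * ℓ))) (Ioi σ₁) ∧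
    ∫ σ in Ioi σ₁, (K * Real.exp (-(σ - σ₁)) + L * Real.exp (-((σ - σ₁) * ℓ))) = K + L / ℓ := by
  have h1i : IntegrableOn (fun σ : ℝ ↦ Real.exp (-(σ - σ₁))) (Ioi σ₁) := by
    have h : IntegrableOn (fun σ : ℝ ↦ Real.exp σ₁ * Real.exp (-1 * σ)) (Ioi σ₁) :=
      (integrableOn_exp_mul_Ioi (a := -1) (by norm_num) σ₁).const_mul (Real.exp σ₁)
    refine h.congr_fun (fun σ _ ↦ ?_) measurableSet_Ioi
    simp only
    rw [← Real.exp_add]; congr 1; ring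
  have h2i : IntegrableOn (fun σ : ℝ ↦ Real.exp (-((σ - σ₁) * ℓ))) (Ioi σ₁) := by
    have h : IntegrableOn (fun σ : ℝ ↦ Real.exp (σ₁ * ℓ) * Real.exp (-ℓ * σ)) (Ioi σ₁) :=
      (integrableOn_exp_mul_Ioi (a := -ℓ) (by linarith) σ₁).const_mul (Real.exp (σ₁ * ℓ))
    refine h.congr_fun (fun σ _ ↦ ?_) measurableSet_Ioi
    simp only
    rw [← Real.exp_add]; congr 1; ring
  have h1 : ∫ σ in Ioi σ₁, Real.exp (-(σ - σ₁)) = 1 := by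
    have e : (fun σ : ℝ ↦ Real.exp (-(σ - σ₁))) = fun σ : ℝ ↦ Real.exp σ₁ * Real.exp (-1 * σ) := by
      funext σ; rw [← Real.exp_add]; congr 1; ring
    rw [e, MeasureTheory.integral_const_mul, integral_exp_mul_Ioi (by norm_num) σ₁, ← mul_div_assoc,
      mul_neg, ← Real.exp_add]
    norm_num
  have h2 : ∫ σ in Ioi σ₁, Real.exp (-((σ - σ₁) * ℓ)) = 1 / ℓ := by
    have e : (fun σ : ℝ ↦ Real.exp (-((σ - σ₁) * ℓ))) = fun σ : ℝ ↦ Real.exp (σ₁ * ℓ) * Real.exp (-ℓ * σ) := by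
      funext σ; rw [← Real.exp_add]; congr 1; ring
    rw [e, MeasureTheory.integral_const_mul, integral_exp_mul_Ioi (by linarith) σ₁, ← mul_div_assoc,
      mul_neg, ← Real.exp_add, show σ₁ * ℓ + -ℓ * σ₁ = 0 by ring, Real.exp_zero]
    field_simp
  refine ⟨(h1i.const_mul K).add (h2i.const_mul L), ?_⟩
  rw [integral_add (h1i.const_mul K) (h2i.const_mul L), MeasureTheory.integral_const_mul,
    MeasureTheory.integral_const_mul, h1, h2]
  ring

/-! ## `J₃`: the segment `½ ≤ σ ≤ σ_{x,t}` -/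

/-- If `t` is not the ordinate of a zero, the zeros stay uniformly away from the line `Im s = t`:
`c(1 + γ²) ≤ (t − γ)²` for all non-trivial zeros, for some `c > 0`. [folklore] -/
theorem exists_pos_mul_le_sq_sub_im {t : ℝ} (hT' : ∀ ρ : ℂ, riemannZeta ρ = 0 → ρ.im ≠ t) :
    ∃ c : ℝ, 0 < c ∧ ∀ ρ ∈ RHWave0.riemannZetaNontrivialZeros, c * (1 + ρ.im ^ 2) ≤ (t - ρ.im) ^ 2 := by
  classical
  have hfin := riemannZetaNontrivialZeros_finite_inter_ball (t * I) 2
  set S := hfin.toFinset with hS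
  set f : ℂ → ℝ := fun ρ ↦ (t - ρ.im) ^ 2 / (1 + ρ.im ^ 2) with hf
  have hfpos : ∀ ρ ∈ S, 0 < f ρ := by
    intro ρ hρ
    rw [hS, Set.Finite.mem_toFinset] at hρ
    have hne : t - ρ.im ≠ 0 :=
      sub_ne_zero.2 (hT' ρ (ZetaZeros.riemannZetaNontrivialZeros.zeta_eq_zero hρ.1)).symm
    rw [hf]; positivity
  obtain ⟨c₁, hc₁0, hc₁⟩ : ∃ c₁ : ℝ, 0 < c₁ ∧ ∀ ρ ∈ S, c₁ ≤ f ρ := by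
    by_cases hne : S.Nonempty
    · obtain ⟨ρ₀, hρ₀, hmin⟩ := S.exists_min_image f hne
      exact ⟨f ρ₀, hfpos ρ₀ hρ₀, hmin⟩
    · exact ⟨1, one_pos, fun ρ hρ ↦ absurd ⟨ρ, hρ⟩ hne⟩
  refine ⟨min c₁ (1 / (3 + 2 * t ^ 2)), lt_min hc₁0 (by positivity), fun ρ hρ ↦ ?_⟩
  have hpos : 0 < 1 + ρ.im ^ 2 := by positivity
  by_cases hb : ρ ∈ Metric.ball (t * I) 2
  · have hρS : ρ ∈ S := by rw [hS, Set.Finite.mem_toFinset]; exact ⟨hρ, hb⟩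
    have h1 := hc₁ ρ hρS
    rw [hf] at h1
    simp only at h1
    rw [le_div_iff₀ hpos] at h1
    calc min c₁ (1 / (3 + 2 * t ^ 2)) * (1 + ρ.im ^ 2) ≤ c₁ * (1 + ρ.im ^ 2) := by
          gcongr; exact min_le_left _ _
      _ ≤ (t - ρ.im) ^ 2 := h1
  · rw [Metric.mem_ball, dist_eq_norm, not_lt] at hb
    have h0 := ZetaZeros.riemannZetaNontrivialZeros.re_pos hρ
    have h1 := ZetaZeros.riemannZetaNontrivialZeros.re_lt_one hρ
    have hd : 1 ≤ |t - ρ.im| := by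
      have := Complex.norm_le_abs_re_add_abs_im (ρ - t * I)
      have hre : (ρ - t * I).re = ρ.re := by simp
      have him : (ρ - t * I).im = ρ.im - t := by simp
      rw [hre, him, abs_of_pos h0, abs_sub_comm] at this
      linarith
    have hd2 : 1 ≤ (t - ρ.im) ^ 2 := by nlinarith [abs_nonneg (t - ρ.im), sq_abs (t - ρ.im)]
    have hγ : ρ.im ^ 2 ≤ 2 * t ^ 2 + 2 * (t - ρ.im) ^ 2 := by nlinarith [sq_nonneg (2 * t - ρ.im)]
    calc min c₁ (1 / (3 + 2 * t ^ 2)) * (1 + ρ.im ^ 2) ≤ 1 / (3 + 2 * t ^ 2) * (1 + ρ.im ^ 2) := by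
          gcongr; exact min_le_right _ _
      _ ≤ (t - ρ.im) ^ 2 := by
          rw [div_mul_eq_mul_div, one_mul, div_le_iff₀ (by positivity)]
          nlinarith

/-- The imaginary part of `1/(s₁−ρ) − 1/(s−ρ)` for `s₁ = σ₁ + it`, `s = σ + it`, `ρ = β + iγ`:
`(t−γ)((σ₁−β)² − (σ−β)²)/(((σ−β)²+(t−γ)²)((σ₁−β)²+(t−γ)²))`. [cite: Titchmarsh1986, §14.21 (J₃)] -/
theorem im_inv_sub_sub (σ₁ σ t : ℝ) (ρ : ℂ) (hd : t - ρ.im ≠ 0) :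
    (1 / (((σ₁ : ℂ)) + t * I - ρ) - 1 / (((σ : ℂ)) + t * I - ρ)).im =
      (t - ρ.im) * ((σ₁ - ρ.re) ^ 2 - (σ - ρ.re) ^ 2) /
        (((σ - ρ.re) ^ 2 + (t - ρ.im) ^ 2) * ((σ₁ - ρ.re) ^ 2 + (t - ρ.im) ^ 2)) := by
  have hA : (σ - ρ.re) ^ 2 + (t - ρ.im) ^ 2 ≠ 0 := by positivity
  have hA₁ : (σ₁ - ρ.re) ^ 2 + (t - ρ.im) ^ 2 ≠ 0 := by positivity
  have e1 : (1 / (((σ₁ : ℂ)) + t * I - ρ)).im = -(t - ρ.im) / ((σ₁ - ρ.re) ^ 2 + (t - ρ.im) ^ 2) := by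
    rw [one_div, Complex.inv_im, Complex.normSq_apply]
    simp only [sub_im, add_im, Complex.ofReal_im, mul_im, Complex.ofReal_re, Complex.I_im, mul_one,
      Complex.I_re, mul_zero, add_zero, zero_add, sub_re, add_re, mul_re, sub_self]
    congr 1; ring
  have e2 : (1 / (((σ : ℂ)) + t * I - ρ)).im = -(t - ρ.im) / ((σ - ρ.re) ^ 2 + (t - ρ.im) ^ 2) := by
    rw [one_div, Complex.inv_im, Complex.normSq_apply]
    simp only [sub_im, add_im, Complex.ofReal_im, mul_im, Complex.ofReal_re, Complex.I_im, mul_one,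
      Complex.I_re, mul_zero, add_zero, zero_add, sub_re, add_re, mul_re, sub_self]
    congr 1; ring
  rw [Complex.sub_im, e1, e2]
  field_simp
  ring

/-- `|Im(1/(s₁−ρ) − 1/(s−ρ))| ≤ |t−γ|(σ₁−σ)(|σ₁−β| + |σ−β|)/(AA₁)` for `σ ≤ σ₁`. [cite: Titchmarsh1986, §14.21 (J₃)] -/
theorem abs_im_inv_sub_sub_le {σ₁ σ t : ℝ} (hσ : σ ≤ σ₁) (ρ : ℂ) (hd : t - ρ.im ≠ 0) :
    |(1 / (((σ₁ : ℂ)) + t * I - ρ) - 1 / (((σ : ℂ)) + t * I - ρ)).im| ≤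
      |t - ρ.im| * (σ₁ - σ) * (|σ₁ - ρ.re| + |σ - ρ.re|) /
        (((σ - ρ.re) ^ 2 + (t - ρ.im) ^ 2) * ((σ₁ - ρ.re) ^ 2 + (t - ρ.im) ^ 2)) := by
  rw [im_inv_sub_sub σ₁ σ t ρ hd, abs_div, abs_mul]
  have hA : 0 < (σ - ρ.re) ^ 2 + (t - ρ.im) ^ 2 := by positivity
  have hA₁ : 0 < (σ₁ - ρ.re) ^ 2 + (t - ρ.im) ^ 2 := by positivity
  rw [abs_of_pos (mul_pos hA hA₁)]
  refine div_le_div_of_nonneg_right ?_ (by positivity)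
  rw [mul_assoc]
  refine mul_le_mul_of_nonneg_left ?_ (abs_nonneg _)
  have hid : (σ₁ - ρ.re) ^ 2 - (σ - ρ.re) ^ 2 = (σ₁ - σ) * ((σ₁ - ρ.re) + (σ - ρ.re)) := by ring
  rw [hid, abs_mul, abs_of_nonneg (by linarith)]
  exact mul_le_mul_of_nonneg_left (abs_add_le _ _) (by linarith)

/-- `∫_a^b |d|/((σ−β)² + d²) dσ ≤ π` (`d ≠ 0`): the integrand is the derivative of
`arctan((σ−β)/|d|)`. [folklore] -/
theorem integral_abs_div_sq_add_sq_le_pi (a b β : ℝ) {d : ℝ} (hd : d ≠ 0) :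
    ∫ σ in a..b, |d| / ((σ - β) ^ 2 + d ^ 2) ≤ π := by
  have hd0 : 0 < |d| := abs_pos.2 hd
  have hderiv : ∀ σ : ℝ, HasDerivAt (fun σ : ℝ ↦ Real.arctan ((σ - β) / |d|))
      (|d| / ((σ - β) ^ 2 + d ^ 2)) σ := by
    intro σ
    have h1 : HasDerivAt (fun σ : ℝ ↦ (σ - β) / |d|) (1 / |d|) σ := by
      simpa using ((hasDerivAt_id σ).sub_const β).div_const |d|
    have h2 := h1.arctan
    refine h2.congr_deriv ?_
    have hsq : d ^ 2 = |d| ^ 2 := (sq_abs d).symm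
    rw [hsq]; field_simp; ring
  have hcont : Continuous fun σ : ℝ ↦ |d| / ((σ - β) ^ 2 + d ^ 2) :=
    Continuous.div continuous_const (by fun_prop) fun σ ↦ by positivity
  rw [intervalIntegral.integral_eq_sub_of_hasDerivAt (fun σ _ ↦ hderiv σ) (hcont.intervalIntegrable _ _)]
  have h1 := Real.arctan_lt_pi_div_two ((b - β) / |d|)
  have h2 := Real.neg_pi_div_two_lt_arctan ((a - β) / |d|)
  linarith

/-- `∫_a^b |d|/((σ−β)² + d²) dσ ≤ (b−a)/|d|` (`d ≠ 0`, `a ≤ b`). [folklore] -/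
theorem integral_abs_div_sq_add_sq_le_div {a b β d : ℝ} (hab : a ≤ b) (hd : d ≠ 0) :
    ∫ σ in a..b, |d| / ((σ - β) ^ 2 + d ^ 2) ≤ (b - a) / |d| := by
  have hd0 : 0 < |d| := abs_pos.2 hd
  have hcont : Continuous fun σ : ℝ ↦ |d| / ((σ - β) ^ 2 + d ^ 2) :=
    Continuous.div continuous_const (by fun_prop) fun σ ↦ by positivity
  have hle : ∀ σ ∈ Icc a b, |d| / ((σ - β) ^ 2 + d ^ 2) ≤ 1 / |d| := by
    intro σ _
    rw [div_le_div_iff₀ (by positivity) hd0, ← sq_abs d]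
    nlinarith [sq_nonneg (σ - β), abs_nonneg d]
  calc ∫ σ in a..b, |d| / ((σ - β) ^ 2 + d ^ 2) ≤ ∫ _ in a..b, 1 / |d| :=
        intervalIntegral.integral_mono_on hab (hcont.intervalIntegrable _ _) intervalIntegrable_const hle
    _ = (b - a) / |d| := by rw [intervalIntegral.integral_const, smul_eq_mul]; ring

/-- `|d||σ−β|/((σ−β)² + d²) ≤ ½`. [folklore] -/
theorem abs_mul_abs_div_le_half (σ β d : ℝ) (hd : d ≠ 0) :
    |d| * |σ - β| / ((σ - β) ^ 2 + d ^ 2) ≤ 1 / 2 := by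
  rw [div_le_iff₀ (by positivity), ← sq_abs d, ← sq_abs (σ - β)]
  nlinarith [sq_nonneg (|d| - |σ - β|)]

/-- **The contribution of one zero to `J₃`** (Titchmarsh p. 347): with `σ₁ = ½ + δ`, `d = t − γ ≠ 0`,
`A₁ = (σ₁−β)² + d²`,
`∫_{½}^{σ₁} |Im(1/(s₁−ρ) − 1/(s−ρ))| dσ ≤ δ(|σ₁−β| min(π, δ/|d|) + δ/2)/A₁`.
[cite: Titchmarsh1986, §14.21 (J₃)] -/
theorem integral_abs_im_le {δ t : ℝ} (hδ : 0 < δ) (ρ : ℂ) (hd : t - ρ.im ≠ 0) :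
    ∫ σ in (1 / 2 : ℝ)..(1 / 2 + δ), |(1 / ((((1 / 2 + δ : ℝ)) : ℂ) + t * I - ρ) - 1 / (((σ : ℂ)) + t * I - ρ)).im| ≤
      δ * (|1 / 2 + δ - ρ.re| * min π (δ / |t - ρ.im|) + δ / 2) /
        ((1 / 2 + δ - ρ.re) ^ 2 + (t - ρ.im) ^ 2) := by
  set σ₁ : ℝ := 1 / 2 + δ with hσ₁
  set β : ℝ := ρ.re with hβ
  set d : ℝ := t - ρ.im with hdd
  set A₁ : ℝ := (σ₁ - β) ^ 2 + d ^ 2 with hA₁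
  have hd0 : 0 < |d| := abs_pos.2 hd
  have hA₁0 : 0 < A₁ := by rw [hA₁]; positivity
  have hab : (1 / 2 : ℝ) ≤ σ₁ := by rw [hσ₁]; linarith
  -- pointwise bound on `[½, σ₁]`
  set g : ℝ → ℝ := fun σ ↦ δ * |σ₁ - β| / A₁ * (|d| / ((σ - β) ^ 2 + d ^ 2)) + δ / (2 * A₁) with hg
  have hpt : ∀ σ ∈ Icc (1 / 2 : ℝ) σ₁,
      |(1 / (((σ₁ : ℂ)) + t * I - ρ) - 1 / (((σ : ℂ)) + t * I - ρ)).im| ≤ g σ := by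
    intro σ hσ
    have hσσ : σ ≤ σ₁ := hσ.2
    have hA : 0 < (σ - β) ^ 2 + d ^ 2 := by positivity
    refine (abs_im_inv_sub_sub_le hσσ ρ hd).trans ?_
    rw [← hβ, ← hdd, ← hA₁, hg]
    simp only
    have hlen : σ₁ - σ ≤ δ := by rw [hσ₁]; linarith [hσ.1]
    have hlen0 : 0 ≤ σ₁ - σ := by linarith
    -- split the two terms
    have e : |d| * (σ₁ - σ) * (|σ₁ - β| + |σ - β|) / (((σ - β) ^ 2 + d ^ 2) * A₁) =
        (σ₁ - σ) * |σ₁ - β| / A₁ * (|d| / ((σ - β) ^ 2 + d ^ 2)) +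
          (σ₁ - σ) / A₁ * (|d| * |σ - β| / ((σ - β) ^ 2 + d ^ 2)) := by
      field_simp
    rw [e]
    have t1 : (σ₁ - σ) * |σ₁ - β| / A₁ * (|d| / ((σ - β) ^ 2 + d ^ 2)) ≤
        δ * |σ₁ - β| / A₁ * (|d| / ((σ - β) ^ 2 + d ^ 2)) := by
      gcongr
    have t2 : (σ₁ - σ) / A₁ * (|d| * |σ - β| / ((σ - β) ^ 2 + d ^ 2)) ≤ δ / A₁ * (1 / 2) := by
      have h2 := abs_mul_abs_div_le_half σ β d hd
      have h3 : (σ₁ - σ) / A₁ ≤ δ / A₁ := div_le_div_of_nonneg_right hlen hA₁0.le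
      exact mul_le_mul h3 h2 (by positivity) (by positivity)
    have : δ / A₁ * (1 / 2) = δ / (2 * A₁) := by field_simp
    linarith
  have hcontg : Continuous g := by
    rw [hg]
    refine Continuous.add (continuous_const.mul (Continuous.div continuous_const (by fun_prop)
      fun σ ↦ by positivity)) continuous_const
  have hmeas : IntervalIntegrable (fun σ : ℝ ↦
      |(1 / (((σ₁ : ℂ)) + t * I - ρ) - 1 / (((σ : ℂ)) + t * I - ρ)).im|) volume (1 / 2) σ₁ := by
    refine ContinuousOn.intervalIntegrable ?_
    rw [Set.uIcc_of_le hab]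
    refine ContinuousOn.abs (Continuous.continuousOn ?_)
    refine Complex.continuous_im.comp (continuous_const.sub ?_)
    refine Continuous.div continuous_const (by fun_prop) fun σ ↦ ?_
    intro h0
    have := congrArg Complex.im h0
    simp at this
    exact hd (by rw [hdd]; linarith)
  have hh : Continuous fun σ : ℝ ↦ |d| / ((σ - β) ^ 2 + d ^ 2) :=
    Continuous.div continuous_const (by fun_prop) fun σ ↦ by positivity
  have hI : ∫ σ in (1 / 2 : ℝ)..σ₁, g σ =
      δ * |σ₁ - β| / A₁ * (∫ σ in (1 / 2 : ℝ)..σ₁, |d| / ((σ - β) ^ 2 + d ^ 2)) +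
        δ / (2 * A₁) * (σ₁ - 1 / 2) := by
    have i1 : ∫ σ in (1 / 2 : ℝ)..σ₁, δ * |σ₁ - β| / A₁ * (|d| / ((σ - β) ^ 2 + d ^ 2)) =
        δ * |σ₁ - β| / A₁ * (∫ σ in (1 / 2 : ℝ)..σ₁, |d| / ((σ - β) ^ 2 + d ^ 2)) :=
      intervalIntegral.integral_const_mul _ _
    have i2 : ∫ _ in (1 / 2 : ℝ)..σ₁, δ / (2 * A₁) = (σ₁ - 1 / 2) * (δ / (2 * A₁)) := by
      rw [intervalIntegral.integral_const, smul_eq_mul]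
    have i3 : ∫ σ in (1 / 2 : ℝ)..σ₁, g σ =
        (∫ σ in (1 / 2 : ℝ)..σ₁, δ * |σ₁ - β| / A₁ * (|d| / ((σ - β) ^ 2 + d ^ 2))) +
          ∫ _ in (1 / 2 : ℝ)..σ₁, δ / (2 * A₁) := by
      simp only [hg]
      exact intervalIntegral.integral_add ((hh.intervalIntegrable _ _).const_mul _) intervalIntegrable_const
    rw [i3, i1, i2]; ring
  have hJ1 : ∫ σ in (1 / 2 : ℝ)..σ₁, |d| / ((σ - β) ^ 2 + d ^ 2) ≤ min π (δ / |d|) := by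
    refine le_min (integral_abs_div_sq_add_sq_le_pi _ _ β hd) ?_
    have := integral_abs_div_sq_add_sq_le_div (β := β) hab hd
    rwa [show σ₁ - 1 / 2 = δ by rw [hσ₁]; ring] at this
  have hc1 : 0 ≤ δ * |σ₁ - β| / A₁ := by positivity
  have hc2 : 0 ≤ δ / (2 * A₁) := by positivity
  calc ∫ σ in (1 / 2 : ℝ)..σ₁, |(1 / (((σ₁ : ℂ)) + t * I - ρ) - 1 / (((σ : ℂ)) + t * I - ρ)).im|
      ≤ ∫ σ in (1 / 2 : ℝ)..σ₁, g σ :=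
        intervalIntegral.integral_mono_on hab hmeas (hcontg.intervalIntegrable _ _) hpt
    _ = δ * |σ₁ - β| / A₁ * (∫ σ in (1 / 2 : ℝ)..σ₁, |d| / ((σ - β) ^ 2 + d ^ 2)) +
          δ / (2 * A₁) * (σ₁ - 1 / 2) := hI
    _ ≤ δ * |σ₁ - β| / A₁ * min π (δ / |d|) + δ / (2 * A₁) * δ := by
        refine add_le_add (mul_le_mul_of_nonneg_left hJ1 hc1) (mul_le_mul_of_nonneg_left ?_ hc2)
        rw [hσ₁]; linarith
    _ = δ * (|σ₁ - β| * min π (δ / |d|) + δ / 2) / A₁ := by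
        field_simp

/-- **Summing over the zeros**: for a non-trivial zero `ρ` and `σ₁ = σ_{x,t}`,
`δ(|σ₁−β| min(π, δ/|d|) + δ/2)/A₁ ≤ 21 δ w_ρ` (near zeros: `|σ₁−β| ≤ 3δ/2`, `A₁ ≥ (δ²+d²)/4`,
`6π + 2 < 21`; far zeros: `|d| > 6v > 3δ`, `|σ₁−β| ≤ δ + |d|/6`, use `δ/|d|`). [cite: Titchmarsh1986, §14.21 (J₃)] -/
theorem perZero_bound_le {ℓ t : ℝ} (hℓ : 0 < ℓ) {ρ : ℂ} (hρ : ρ ∈ RHWave0.riemannZetaNontrivialZeros)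
    (hd : t - ρ.im ≠ 0) :
    SelbergSigma.delta ℓ t * (|1 / 2 + SelbergSigma.delta ℓ t - ρ.re| *
        min π (SelbergSigma.delta ℓ t / |t - ρ.im|) + SelbergSigma.delta ℓ t / 2) /
        ((1 / 2 + SelbergSigma.delta ℓ t - ρ.re) ^ 2 + (t - ρ.im) ^ 2) ≤
      21 * SelbergSigma.delta ℓ t * SelbergSigma.wt (SelbergSigma.delta ℓ t) t ρ := by
  set δ := SelbergSigma.delta ℓ t with hδ
  have hδ0 : 0 < δ := SelbergSigma.delta_pos hℓ t
  set d : ℝ := t - ρ.im with hdd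
  have hd0 : 0 < |d| := abs_pos.2 hd
  set e : ℝ := ρ.re - 1 / 2 with he
  have hve : SelbergSigma.dev ρ = |e| := by rw [SelbergSigma.dev, he]
  rw [SelbergSigma.wt, ← hdd]
  have hmin0 : 0 ≤ min π (δ / |d|) := le_min Real.pi_pos.le (by positivity)
  have hminπ : min π (δ / |d|) ≤ π := min_le_left _ _
  have hmind : min π (δ / |d|) ≤ δ / |d| := min_le_right _ _
  have hπ : π < 3.15 := Real.pi_lt_d2
  have hA0 : 0 < δ ^ 2 + d ^ 2 := by positivity
  rw [show 1 / 2 + δ - ρ.re = δ - e by rw [he]; ring]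
  have hA₁0 : 0 < (δ - e) ^ 2 + d ^ 2 := by positivity
  rw [div_le_iff₀ hA₁0, show 21 * δ * (δ / (δ ^ 2 + d ^ 2)) * ((δ - e) ^ 2 + d ^ 2) =
    21 * δ * δ * (((δ - e) ^ 2 + d ^ 2) / (δ ^ 2 + d ^ 2)) by ring]
  by_cases hn : SelbergSigma.IsNear ℓ t ρ
  · -- near: `|e| ≤ δ/2`
    have hv : |e| ≤ δ / 2 := by rw [← hve]; exact SelbergSigma.dev_le_half_delta hℓ hρ hn
    have he1 : |δ - e| ≤ 3 / 2 * δ := by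
      rw [abs_le] at hv ⊢; constructor <;> linarith [hv.1, hv.2]
    have hA₁ : (δ ^ 2 + d ^ 2) / 4 ≤ (δ - e) ^ 2 + d ^ 2 := by
      rw [abs_le] at hv; nlinarith [hv.1, hv.2]
    have hratio : 1 / 4 ≤ ((δ - e) ^ 2 + d ^ 2) / (δ ^ 2 + d ^ 2) := by
      rw [le_div_iff₀ hA0]; linarith
    have hm : |δ - e| * min π (δ / |d|) ≤ 3 / 2 * δ * π := mul_le_mul he1 hminπ hmin0 (by positivity)
    calc δ * (|δ - e| * min π (δ / |d|) + δ / 2) ≤ δ * (3 / 2 * δ * π + δ / 2) :=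
          mul_le_mul_of_nonneg_left (by linarith) hδ0.le
      _ ≤ 21 * δ * δ * (1 / 4) := by nlinarith
      _ ≤ 21 * δ * δ * (((δ - e) ^ 2 + d ^ 2) / (δ ^ 2 + d ^ 2)) :=
          mul_le_mul_of_nonneg_left hratio (by positivity)
  · -- far: `6|e| < |d|`, hence `|e| > δ/2` is not needed; but we need `|d| > 3δ`? Only if `|e| > δ/2`.
    have h6 : 6 * |e| < |d| := by rw [← hve, hdd]; exact SelbergSigma.six_mul_dev_lt_of_far hℓ hn
    -- two subcases: `|e| ≤ δ/2` behaves like a near zero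
    rcases le_or_gt |e| (δ / 2) with hv | hv
    · have he1 : |δ - e| ≤ 3 / 2 * δ := by
        rw [abs_le] at hv ⊢; constructor <;> linarith [hv.1, hv.2]
      have hA₁ : (δ ^ 2 + d ^ 2) / 4 ≤ (δ - e) ^ 2 + d ^ 2 := by
        rw [abs_le] at hv; nlinarith [hv.1, hv.2]
      have hratio : 1 / 4 ≤ ((δ - e) ^ 2 + d ^ 2) / (δ ^ 2 + d ^ 2) := by
        rw [le_div_iff₀ hA0]; linarith
      have hm : |δ - e| * min π (δ / |d|) ≤ 3 / 2 * δ * π := mul_le_mul he1 hminπ hmin0 (by positivity)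
      calc δ * (|δ - e| * min π (δ / |d|) + δ / 2) ≤ δ * (3 / 2 * δ * π + δ / 2) :=
            mul_le_mul_of_nonneg_left (by linarith) hδ0.le
        _ ≤ 21 * δ * δ * (1 / 4) := by nlinarith
        _ ≤ 21 * δ * δ * (((δ - e) ^ 2 + d ^ 2) / (δ ^ 2 + d ^ 2)) :=
            mul_le_mul_of_nonneg_left hratio (by positivity)
    · have hd3 : 3 * δ < |d| := by linarith
      have he1 : |δ - e| ≤ δ + |d| / 6 := by
        refine (abs_sub _ _).trans ?_; rw [abs_of_pos hδ0]; linarith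
      have hA₁ : 9 / 10 * (δ ^ 2 + d ^ 2) ≤ (δ - e) ^ 2 + d ^ 2 := by
        have h9 : (3 * δ) ^ 2 < |d| ^ 2 := pow_lt_pow_left₀ hd3 (by positivity) two_ne_zero
        rw [sq_abs] at h9
        nlinarith [sq_nonneg (δ - e)]
      have hratio : 9 / 10 ≤ ((δ - e) ^ 2 + d ^ 2) / (δ ^ 2 + d ^ 2) := by
        rw [le_div_iff₀ hA0]; linarith
      -- `|δ - e| * (δ/|d|) ≤ (δ + |d|/6) δ/|d| = δ²/|d| + δ/6 ≤ δ/3 + δ/6`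
      have hdd3 : δ / |d| ≤ 1 / 3 := by rw [div_le_iff₀ hd0]; linarith
      have hmain : |δ - e| * min π (δ / |d|) ≤ δ / 2 := by
        calc |δ - e| * min π (δ / |d|) ≤ (δ + |d| / 6) * (δ / |d|) :=
              mul_le_mul he1 hmind hmin0 (by positivity)
          _ = δ * (δ / |d|) + δ / 6 := by field_simp
          _ ≤ δ * (1 / 3) + δ / 6 := by
              have := mul_le_mul_of_nonneg_left hdd3 hδ0.le; linarith
          _ = δ / 2 := by ring
      calc δ * (|δ - e| * min π (δ / |d|) + δ / 2) ≤ δ * (δ / 2 + δ / 2) :=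
            mul_le_mul_of_nonneg_left (by linarith) hδ0.le
        _ ≤ 21 * δ * δ * (9 / 10) := by nlinarith
        _ ≤ 21 * δ * δ * (((δ - e) ^ 2 + d ^ 2) / (δ ^ 2 + d ^ 2)) :=
            mul_le_mul_of_nonneg_left hratio (by positivity)

/-! ## Assembly: the unconditional Theorem 14.21 -/

/-- The pole and `Γ` terms of `ζ'/ζ(s₁) − ζ'/ζ(s)` along `½ ≤ σ ≤ σ₁ ≤ 3/2` at height `t ≥ 1`:
`‖(1/s₁ − 1/s) + (1/(s₁−1) − 1/(s−1)) + (Γℝ'/Γℝ(s₁) − Γℝ'/Γℝ(s))‖ ≤ 4/t + log(|t|+4) + 10`.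
[folklore] -/
theorem norm_bracket_le {σ₁ σ t : ℝ} (hσ : 1 / 2 ≤ σ) (hσ₁ : σ₁ ≤ 3 / 2) (hσσ : σ ≤ σ₁) (ht : 1 ≤ t) :
    ‖(1 / ((σ₁ : ℂ) + t * I) - 1 / ((σ : ℂ) + t * I)) +
        (1 / ((σ₁ : ℂ) + t * I - 1) - 1 / ((σ : ℂ) + t * I - 1)) +
        (logDeriv Gammaℝ ((σ₁ : ℂ) + t * I) - logDeriv Gammaℝ ((σ : ℂ) + t * I))‖ ≤
      4 / t + Real.log (|t| + 4) + 10 := by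
  have ht0 : 0 < t := by linarith
  have hinv : ∀ (x : ℝ) (z : ℂ), z.im = t → ‖1 / z‖ ≤ 1 / t := by
    intro x z hz
    have hz0 : z ≠ 0 := fun h ↦ by rw [h, Complex.zero_im] at hz; linarith
    rw [norm_div, norm_one, div_le_div_iff₀ (norm_pos_iff.2 hz0) ht0, one_mul, one_mul]
    have := Complex.abs_im_le_norm z
    rw [hz, abs_of_pos ht0] at this
    exact this
  have h2t : (2 : ℝ) / t = 1 / t + 1 / t := by ring
  have h1 : ‖1 / ((σ₁ : ℂ) + t * I) - 1 / ((σ : ℂ) + t * I)‖ ≤ 2 / t := by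
    refine (norm_sub_le _ _).trans ?_
    have e1 := hinv σ₁ ((σ₁ : ℂ) + t * I) (by simp)
    have e2 := hinv σ ((σ : ℂ) + t * I) (by simp)
    linarith
  have h2 : ‖1 / ((σ₁ : ℂ) + t * I - 1) - 1 / ((σ : ℂ) + t * I - 1)‖ ≤ 2 / t := by
    refine (norm_sub_le _ _).trans ?_
    have e1 := hinv σ₁ ((σ₁ : ℂ) + t * I - 1) (by simp)
    have e2 := hinv σ ((σ : ℂ) + t * I - 1) (by simp)
    linarith
  have hΓ : ∀ x : ℝ, 1 / 2 ≤ x → x ≤ 3 / 2 →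
      ‖logDeriv Gammaℝ ((x : ℂ) + t * I)‖ ≤ Real.log (|t| + 4) / 2 + 5 := fun x hx1 hx2 ↦
    norm_logDeriv_Gammaℝ_le (by linarith) (by linarith) (by rw [abs_of_pos ht0]; exact ht)
  have h3 : ‖logDeriv Gammaℝ ((σ₁ : ℂ) + t * I) - logDeriv Gammaℝ ((σ : ℂ) + t * I)‖ ≤
      Real.log (|t| + 4) + 10 := by
    refine (norm_sub_le _ _).trans ?_
    have e1 := hΓ σ₁ (by linarith) hσ₁
    have e2 := hΓ σ hσ (by linarith)
    linarith
  refine (norm_add_le _ _).trans ?_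
  refine (add_le_add ((norm_add_le _ _).trans (add_le_add h1 h2)) h3).trans ?_
  have : 2 / t + 2 / t = 4 / t := by ring
  linarith

/-- `ζ'/ζ(s) = ξ'/ξ(s) − 1/s − 1/(s−1) − Γℝ'/Γℝ(s)` at `s = σ + it`, `σ ≥ ½`, `t ≠ 0`, `ζ(s) ≠ 0`.
[folklore] -/
theorem logDeriv_zeta_eq_line {σ t : ℝ} (hσ : 1 / 2 ≤ σ) (ht : t ≠ 0) (hζ : riemannZeta (σ + t * I) ≠ 0) :
    deriv riemannZeta (σ + t * I) / riemannZeta (σ + t * I) =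
      logDeriv riemannXi (σ + t * I) - 1 / ((σ : ℂ) + t * I) - 1 / ((σ : ℂ) + t * I - 1) -
        logDeriv Gammaℝ ((σ : ℂ) + t * I) :=
  PsiOneExplicit.logDeriv_riemannZeta_eq_logDeriv_riemannXi (by simp; linarith)
    (fun h ↦ ht (by have := congrArg Complex.im h; simpa using this))
    (fun h ↦ ht (by have := congrArg Complex.im h; simpa using this)) hζ

set_option maxHeartbeats 1600000 in
/-- **Selberg's approximate formula for `S(t)`, pointwise** (the unconditional form of
Titchmarsh's Theorem 14.21; Selberg 1946). There is an absolute constant `C` such that for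
`ℓ ≥ 8`, `t > 0` with `ℓ ≤ 2 log t` (`x = e^ℓ`), `t` not the ordinate of a zero, and any `N` with
`x³ ≤ N` (`3ℓ ≤ log N`):

  `|π S(t) − Im Σ_{2 ≤ n < N} Λ(n) f_ℓ(log n) n^{−σ_{x,t}−it}/log n|`
  `   ≤ C (σ_{x,t} − ½) (‖Σ_{n} Λ(n) f_ℓ(log n) n^{−σ_{x,t}−it}‖ + log t)`,

where `Λ(n) f_ℓ(log n) = Λ_x(n)` are Selberg's weights and `σ_{x,t} = ½ + delta ℓ t`.
(Titchmarsh: `S(t) = −π⁻¹ Σ_{n<x²} Λ_x(n) n^{−σ₁} sin(t log n)/log n + O((σ₁−½)|Σ Λ_x(n) n^{−σ₁−it}|) +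
O((σ₁−½) log t)` with `σ₁ = ½ + 1/log x` on RH.) [cite: Titchmarsh1986, Thm. 14.21] -/
theorem selberg_approx_pointwise : ∃ C : ℝ, 0 < C ∧ ∀ ℓ t : ℝ, 8 ≤ ℓ → 0 < t → ℓ ≤ 2 * Real.log t →
    (∀ ρ : ℂ, riemannZeta ρ = 0 → ρ.im ≠ t) → ∀ N : ℕ, 2 ≤ N → 3 * ℓ ≤ Real.log N →
    |π * zetaArgS t - (∑ n ∈ Finset.Ico 2 N,
        ((ArithmeticFunction.vonMangoldt n : ℝ) : ℂ) * (SelbergExplicit.smoothing ℓ (Real.log n) : ℂ) *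
          ((n : ℂ) ^ (-((((1 / 2 + SelbergSigma.delta ℓ t : ℝ)) : ℂ) + t * I)) / (Real.log n : ℂ))).im| ≤
      C * SelbergSigma.delta ℓ t *
        (‖fordK (SelbergExplicit.smoothing ℓ) ((((1 / 2 + SelbergSigma.delta ℓ t : ℝ)) : ℂ) + t * I)‖ +
          Real.log t) := by
  obtain ⟨CW, hCW0, hCW⟩ := SelbergSigma.W_le
  set CJ := SelbergExplicit.norm_remainder_le.choose with hCJdef
  obtain ⟨hCJ0, hCJb⟩ := SelbergExplicit.norm_remainder_le.choose_spec
  set B₀ : ℝ := ∑' n : ℕ, (ArithmeticFunction.vonMangoldt n : ℝ) * (n : ℝ) ^ (-(5 / 4 : ℝ)) with hB₀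
  have hB₀0 : 0 ≤ B₀ := tsum_nonneg fun n ↦ mul_nonneg ArithmeticFunction.vonMangoldt_nonneg
    (Real.rpow_nonneg (Nat.cast_nonneg n) _)
  refine ⟨200 + 3 * CJ + B₀ + 22 * CW, by positivity, fun ℓ t hℓ ht0 hℓt hT' N hN hxN ↦ ?_⟩
  -- basic quantities
  have hℓ0 : 0 < ℓ := by linarith
  have hℓ1 : 1 ≤ ℓ := by linarith
  have hL4 : 4 ≤ Real.log t := by linarith
  have hL0 : 0 ≤ Real.log t := by linarith
  have ht4 : 4 ≤ t := by
    have h54 : Real.exp 4 ≤ t := by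
      calc Real.exp 4 ≤ Real.exp (Real.log t) := Real.exp_le_exp.2 hL4
        _ = t := Real.exp_log ht0
    linarith [Real.add_one_le_exp (4 : ℝ)]
  have ht1 : 1 ≤ t := by linarith
  set δ := SelbergSigma.delta ℓ t with hδ
  have hδ0 : 0 < δ := SelbergSigma.delta_pos hℓ0 t
  have hδ1 : δ < 1 := SelbergSigma.delta_lt_one (by linarith) t
  have h4δ : 4 / ℓ ≤ δ := SelbergSigma.four_div_le_delta ℓ t
  have hℓδ : 1 / ℓ ≤ δ / 4 := by
    have : (1 : ℝ) / ℓ = (4 / ℓ) / 4 := by ring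
    rw [this]; linarith
  set σ₁ : ℝ := 1 / 2 + δ with hσ₁
  have hσ₁h : (1 / 2 : ℝ) ≤ σ₁ := by rw [hσ₁]; linarith
  have hσ₁32 : σ₁ < 3 / 2 := by rw [hσ₁]; linarith
  set s₁ : ℂ := ((σ₁ : ℝ) : ℂ) + t * I with hs₁
  have ht0' : t ≠ 0 := ht0.ne'
  have hζline : ∀ σ : ℝ, riemannZeta (σ + t * I) ≠ 0 := fun σ h ↦ hT' _ h (by simp)
  -- the objects
  set Fc : ℝ → ℂ := fun σ ↦ deriv riemannZeta (σ + t * I) / riemannZeta (σ + t * I) with hFc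
  set Dc : ℝ → ℂ := fun σ ↦ fordK (SelbergExplicit.smoothing ℓ) (σ + t * I) with hDc
  set D : ℂ := fordK (SelbergExplicit.smoothing ℓ) s₁ with hD
  set W : ℝ := SelbergSigma.W ℓ t with hW
  have hW0 : 0 ≤ W := SelbergSigma.W_nonneg ℓ t hℓ0
  have hWle : W ≤ 6 * ‖D‖ + CW * Real.log t := hCW ℓ t hℓ ht0 hℓt
  ------------------------------------------------------------------
  -- Step 1: `π S(t) = −Im ∫_{(½,∞)} F`
  ------------------------------------------------------------------
  have hS := pi_mul_zetaArgS_eq_neg_integral_Ioi ht0 hT'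
  have hFint : IntegrableOn Fc (Ioi (1 / 2 : ℝ)) := integrableOn_logDeriv_riemannZeta_Ioi_half ht0 hT'
  have hF1 : IntegrableOn Fc (Ioc (1 / 2 : ℝ) σ₁) := hFint.mono_set Ioc_subset_Ioi_self
  have hF2 : IntegrableOn Fc (Ioi σ₁) := hFint.mono_set (Ioi_subset_Ioi hσ₁h)
  have hsplit : ∫ σ in Ioi (1 / 2 : ℝ), Fc σ = (∫ σ in (1 / 2 : ℝ)..σ₁, Fc σ) + ∫ σ in Ioi σ₁, Fc σ := by
    rw [intervalIntegral.integral_of_le hσ₁h,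
      ← setIntegral_union (Ioc_disjoint_Ioi le_rfl) measurableSet_Ioi hF1 hF2,
      Ioc_union_Ioi_eq_Ioi hσ₁h]
  have him : ∫ σ in Ioi (1 / 2 : ℝ), (Fc σ).im = (∫ σ in Ioi (1 / 2 : ℝ), Fc σ).im := integral_im hFint
  ------------------------------------------------------------------
  -- Step 2: `∫_{(σ₁,∞)} F = −M + ∫ R`, `‖∫ R‖ ≤ K + (3/10) W/ℓ`
  ------------------------------------------------------------------
  obtain ⟨hDint, hDval⟩ := integral_Ioi_fordK hℓ0.le hN hxN σ₁ t
  set M : ℂ := ∑ n ∈ Finset.Ico 2 N,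
      ((ArithmeticFunction.vonMangoldt n : ℝ) : ℂ) * (SelbergExplicit.smoothing ℓ (Real.log n) : ℂ) *
        ((n : ℂ) ^ (-(((σ₁ : ℝ) : ℂ) + t * I)) / (Real.log n : ℂ)) with hM
  have hRint : IntegrableOn (fun σ : ℝ ↦ Fc σ + Dc σ) (Ioi σ₁) := hF2.add hDint
  have hJ1 : ∫ σ in Ioi σ₁, Fc σ = -M + ∫ σ in Ioi σ₁, (Fc σ + Dc σ) := by
    rw [integral_add hF2 hDint, hDval]; ring
  -- the majorant
  set K : ℝ := Real.exp 1 * (4 / ℓ ^ 2 + CJ * (1 + Real.log (1 + |t|)) * Real.exp (-ℓ) / ℓ ^ 2 +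
    B₀ * Real.exp (-(ℓ / 4))) with hK
  set g : ℝ → ℝ := fun σ ↦ K * Real.exp (-(σ - σ₁)) + 3 / 10 * W * Real.exp (-((σ - σ₁) * ℓ)) with hg
  obtain ⟨hgint, hgval⟩ := integral_majorant hℓ0 σ₁ K (3 / 10 * W)
  have hRle : ∀ σ ∈ Ioi σ₁, ‖Fc σ + Dc σ‖ ≤ g σ := by
    intro σ hσ
    have h := norm_logDeriv_add_fordK_le_majorant (ℓ := ℓ) (t := t) (σ := σ) hℓ ht1 hℓt
      (by rw [← hδ]; exact hσ)
    rw [← hδ, ← hCJdef, ← hB₀, ← hW] at h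
    rw [hg]; simp only
    rw [show σ - σ₁ = σ - 1 / 2 - δ by rw [hσ₁]; ring]
    exact h
  have hRnorm : ‖∫ σ in Ioi σ₁, (Fc σ + Dc σ)‖ ≤ K + 3 / 10 * W / ℓ := by
    rw [← hgval]
    exact norm_integral_le_of_norm_le hgint ((ae_restrict_iff' measurableSet_Ioi).2 (ae_of_all _ hRle))
  ------------------------------------------------------------------
  -- Step 3: the segment `½ ≤ σ ≤ σ₁`
  ------------------------------------------------------------------
  have hFii : IntervalIntegrable Fc volume (1 / 2) σ₁ :=
    (intervalIntegrable_iff_integrableOn_Ioc_of_le hσ₁h).2 hF1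
  have hJ23 : ∫ σ in (1 / 2 : ℝ)..σ₁, Fc σ = δ * Fc σ₁ - ∫ σ in (1 / 2 : ℝ)..σ₁, (Fc σ₁ - Fc σ) := by
    rw [intervalIntegral.integral_sub intervalIntegrable_const hFii, intervalIntegral.integral_const,
      show σ₁ - 1 / 2 = δ by rw [hσ₁]; ring]
    simp
  -- the bracket `B` and the zero part `Zf`
  set B : ℝ → ℂ := fun σ ↦ (1 / ((σ₁ : ℂ) + t * I) - 1 / ((σ : ℂ) + t * I)) +
    (1 / ((σ₁ : ℂ) + t * I - 1) - 1 / ((σ : ℂ) + t * I - 1)) +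
    (logDeriv Gammaℝ ((σ₁ : ℂ) + t * I) - logDeriv Gammaℝ ((σ : ℂ) + t * I)) with hB
  set gz : RHWave0.riemannZetaNontrivialZeros → ℝ → ℂ := fun ρ σ ↦
    (riemannZetaZeroOrder (ρ : ℂ) : ℂ) * (1 / (((σ₁ : ℂ)) + t * I - ρ) - 1 / (((σ : ℂ)) + t * I - ρ)) with hgz
  set Zf : ℝ → ℂ := fun σ ↦ ∑' ρ : RHWave0.riemannZetaNontrivialZeros, gz ρ σ with hZf
  have hsumZ : ∀ σ : ℝ, HasSum (fun ρ ↦ gz ρ σ) (logDeriv riemannXi s₁ - logDeriv riemannXi (σ + t * I)) :=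
    fun σ ↦ hasSum_zeroOrder_mul_inv_sub_sub (hζline σ₁) (hζline σ)
  have hZf_eq : ∀ σ : ℝ, Zf σ = logDeriv riemannXi s₁ - logDeriv riemannXi (σ + t * I) :=
    fun σ ↦ (hsumZ σ).tsum_eq
  have hdiff : ∀ σ : ℝ, 1 / 2 ≤ σ → Fc σ₁ - Fc σ = Zf σ - B σ := by
    intro σ hσ
    rw [hZf_eq σ, hFc, hB]
    simp only
    rw [logDeriv_zeta_eq_line hσ₁h ht0' (hζline σ₁), logDeriv_zeta_eq_line hσ ht0' (hζline σ)]
    ring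
  -- continuity / integrability of `B` on `[½, σ₁]`
  have hBcont : ContinuousOn B (Set.uIcc (1 / 2 : ℝ) σ₁) := by
    rw [Set.uIcc_of_le hσ₁h]
    intro σ hσ
    have hσ0 : 0 < ((σ : ℂ) + t * I).re := by simp; linarith [hσ.1]
    have hne0 : (σ : ℂ) + t * I ≠ 0 := fun h ↦ ht0' (by have := congrArg Complex.im h; simpa using this)
    have hne1 : (σ : ℂ) + t * I - 1 ≠ 0 := fun h ↦ ht0' (by have := congrArg Complex.im h; simpa using this)
    have hline : Continuous fun σ : ℝ ↦ (σ : ℂ) + t * I := by fun_prop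
    refine ContinuousAt.continuousWithinAt ?_
    have c1 : ContinuousAt (fun σ : ℝ ↦ 1 / ((σ : ℂ) + t * I)) σ :=
      continuousAt_const.div hline.continuousAt hne0
    have c2 : ContinuousAt (fun σ : ℝ ↦ 1 / ((σ : ℂ) + t * I - 1)) σ :=
      continuousAt_const.div (hline.continuousAt.sub continuousAt_const) hne1
    have c3 : ContinuousAt (fun σ : ℝ ↦ logDeriv Gammaℝ ((σ : ℂ) + t * I)) σ :=
      ContinuousAt.comp (f := fun σ : ℝ ↦ (σ : ℂ) + t * I) (analyticAt_logDeriv_Gammaℝ hσ0).continuousAt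
        hline.continuousAt
    rw [hB]
    exact ((continuousAt_const.sub c1).add (continuousAt_const.sub c2)).add (continuousAt_const.sub c3)
  have hBii : IntervalIntegrable B volume (1 / 2) σ₁ := hBcont.intervalIntegrable
  have hZfii : IntervalIntegrable Zf volume (1 / 2) σ₁ := by
    have h1 : IntervalIntegrable (fun σ ↦ (Fc σ₁ - Fc σ) + B σ) volume (1 / 2) σ₁ :=
      (intervalIntegrable_const.sub hFii).add hBii
    refine h1.congr ?_
    rw [Set.uIoc_of_le hσ₁h]
    intro σ hσ
    simp only
    rw [hdiff σ (le_of_lt hσ.1)]; ring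
  have hJ3 : ∫ σ in (1 / 2 : ℝ)..σ₁, (Fc σ₁ - Fc σ) =
      (∫ σ in (1 / 2 : ℝ)..σ₁, Zf σ) - ∫ σ in (1 / 2 : ℝ)..σ₁, B σ := by
    rw [← intervalIntegral.integral_sub hZfii hBii]
    refine intervalIntegral.integral_congr fun σ hσ ↦ ?_
    rw [Set.uIcc_of_le hσ₁h] at hσ
    exact hdiff σ hσ.1
  -- `‖∫ B‖ ≤ δ (4/t + log(|t|+4) + 10)`
  have hBnorm : ‖∫ σ in (1 / 2 : ℝ)..σ₁, B σ‖ ≤ (4 / t + Real.log (|t| + 4) + 10) * δ := by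
    have h := intervalIntegral.norm_integral_le_of_norm_le_const (a := 1 / 2) (b := σ₁) (f := B)
      (C := 4 / t + Real.log (|t| + 4) + 10) ?_
    · rwa [show σ₁ - 1 / 2 = δ by rw [hσ₁]; ring, abs_of_pos hδ0] at h
    · intro σ hσ
      rw [Set.uIoc_of_le hσ₁h] at hσ
      exact norm_bracket_le (le_of_lt hσ.1) hσ₁32.le hσ.2 ht1
  ------------------------------------------------------------------
  -- Step 4: `Im ∫ Zf` via termwise integration
  ------------------------------------------------------------------
  obtain ⟨c, hc0, hc⟩ := exists_pos_mul_le_sq_sub_im hT'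
  set bound : RHWave0.riemannZetaNontrivialZeros → ℝ → ℝ := fun ρ _ ↦
    δ / c * ((riemannZetaZeroOrder (ρ : ℂ) : ℝ) / (1 + (ρ : ℂ).im ^ 2)) with hbound
  have hbsum : Summable fun ρ : RHWave0.riemannZetaNontrivialZeros ↦
      δ / c * ((riemannZetaZeroOrder (ρ : ℂ) : ℝ) / (1 + (ρ : ℂ).im ^ 2)) :=
    ZetaZeroSum.summable_zeroOrder_div_one_add_sq.mul_left _
  have hgz_cont : ∀ ρ : RHWave0.riemannZetaNontrivialZeros, Continuous (gz ρ) := by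
    intro ρ
    rw [hgz]
    refine continuous_const.mul (continuous_const.sub ?_)
    refine Continuous.div continuous_const (by fun_prop) fun σ h0 ↦ ?_
    have := congrArg Complex.im h0
    simp at this
    exact hT' ρ (ZetaZeros.riemannZetaNontrivialZeros.zeta_eq_zero ρ.2) (by linarith)
  have hgz_bound : ∀ (ρ : RHWave0.riemannZetaNontrivialZeros) (σ : ℝ), σ ∈ Set.uIoc (1 / 2 : ℝ) σ₁ →
      ‖gz ρ σ‖ ≤ bound ρ σ := by
    intro ρ σ hσ
    rw [Set.uIoc_of_le hσ₁h] at hσ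
    have hm := ZetaZeroSum.zeroOrder_nonneg ρ
    have hd2 := hc ρ ρ.2
    have hpos : 0 < 1 + (ρ : ℂ).im ^ 2 := by positivity
    have hdpos : 0 < (t - (ρ : ℂ).im) ^ 2 := lt_of_lt_of_le (by positivity) hd2
    rw [hgz, hbound]
    simp only
    rw [norm_mul, Complex.norm_intCast, abs_of_nonneg hm]
    -- `‖1/(s₁−ρ) − 1/(s−ρ)‖ = ‖s − s₁‖/(‖s₁−ρ‖‖s−ρ‖) ≤ δ/(t−γ)²`
    have hρζ := ZetaZeros.riemannZetaNontrivialZeros.zeta_eq_zero ρ.2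
    have hne1 : ((σ₁ : ℂ)) + t * I - ρ ≠ 0 := sub_ne_zero.2 fun e ↦ hζline σ₁ (e ▸ hρζ)
    have hne : ((σ : ℂ)) + t * I - ρ ≠ 0 := sub_ne_zero.2 fun e ↦ hζline σ (e ▸ hρζ)
    have hid : 1 / (((σ₁ : ℂ)) + t * I - ρ) - 1 / (((σ : ℂ)) + t * I - ρ) =
        ((σ : ℂ) - σ₁) / ((((σ₁ : ℂ)) + t * I - ρ) * (((σ : ℂ)) + t * I - ρ)) := by
      field_simp; ring
    rw [hid, norm_div, norm_mul]
    have hn1 : |t - (ρ : ℂ).im| ≤ ‖((σ₁ : ℂ)) + t * I - ρ‖ := by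
      have := Complex.abs_im_le_norm (((σ₁ : ℂ)) + t * I - ρ); simpa using this
    have hn : |t - (ρ : ℂ).im| ≤ ‖((σ : ℂ)) + t * I - ρ‖ := by
      have := Complex.abs_im_le_norm (((σ : ℂ)) + t * I - ρ); simpa using this
    have hnum : ‖(σ : ℂ) - σ₁‖ ≤ δ := by
      rw [show (σ : ℂ) - σ₁ = ((σ - σ₁ : ℝ) : ℂ) by push_cast; ring, Complex.norm_real, Real.norm_eq_abs,
        abs_le]
      constructor <;> linarith [hσ.1, hσ.2]
    have habs0 : 0 < |t - (ρ : ℂ).im| := by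
      refine abs_pos.2 fun h0 ↦ ?_
      rw [h0] at hdpos; simp at hdpos
    have hden : |t - (ρ : ℂ).im| * |t - (ρ : ℂ).im| ≤ ‖((σ₁ : ℂ)) + t * I - ρ‖ * ‖((σ : ℂ)) + t * I - ρ‖ :=
      mul_le_mul hn1 hn (abs_nonneg _) (norm_nonneg _)
    calc (riemannZetaZeroOrder (ρ : ℂ) : ℝ) * (‖(σ : ℂ) - σ₁‖ / (‖((σ₁ : ℂ)) + t * I - ρ‖ * ‖((σ : ℂ)) + t * I - ρ‖))
        ≤ (riemannZetaZeroOrder (ρ : ℂ) : ℝ) * (δ / (|t - (ρ : ℂ).im| * |t - (ρ : ℂ).im|)) :=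
          mul_le_mul_of_nonneg_left (div_le_div₀ hδ0.le hnum (mul_pos habs0 habs0) hden) hm
      _ = (riemannZetaZeroOrder (ρ : ℂ) : ℝ) * (δ / (t - (ρ : ℂ).im) ^ 2) := by rw [← sq, sq_abs]
      _ ≤ (riemannZetaZeroOrder (ρ : ℂ) : ℝ) * (δ / (c * (1 + (ρ : ℂ).im ^ 2))) :=
          mul_le_mul_of_nonneg_left (div_le_div_of_nonneg_left hδ0.le (by positivity) hd2) hm
      _ = δ / c * ((riemannZetaZeroOrder (ρ : ℂ) : ℝ) / (1 + (ρ : ℂ).im ^ 2)) := by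
          field_simp
  haveI : Countable RHWave0.riemannZetaNontrivialZeros := riemannZetaNontrivialZeros_countable.to_subtype
  have hDC : HasSum (fun ρ ↦ ∫ σ in (1 / 2 : ℝ)..σ₁, gz ρ σ) (∫ σ in (1 / 2 : ℝ)..σ₁, Zf σ) := by
    refine intervalIntegral.hasSum_integral_of_dominated_convergence bound
      (fun ρ ↦ (hgz_cont ρ).aestronglyMeasurable) (fun ρ ↦ ae_of_all _ (hgz_bound ρ))
      (ae_of_all _ fun σ _ ↦ hbsum) ?_ (ae_of_all _ fun σ _ ↦ (hsumZ σ).summable.hasSum)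
    simp only [hbound]
    exact intervalIntegrable_const
  have hImsum : HasSum (fun ρ ↦ (∫ σ in (1 / 2 : ℝ)..σ₁, gz ρ σ).im) (∫ σ in (1 / 2 : ℝ)..σ₁, Zf σ).im :=
    Complex.hasSum_im hDC
  -- per-zero bound of the imaginary parts
  have hper : ∀ ρ : RHWave0.riemannZetaNontrivialZeros,
      ‖(∫ σ in (1 / 2 : ℝ)..σ₁, gz ρ σ).im‖ ≤
        21 * δ * ((riemannZetaZeroOrder (ρ : ℂ) : ℝ) * SelbergSigma.wt δ t ρ) := by
    intro ρ
    have hm := ZetaZeroSum.zeroOrder_nonneg ρ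
    have hd2 := hc ρ ρ.2
    have hdpos : 0 < (t - (ρ : ℂ).im) ^ 2 := lt_of_lt_of_le (by positivity) hd2
    have hdne : t - (ρ : ℂ).im ≠ 0 := fun h0 ↦ by rw [h0] at hdpos; simp at hdpos
    set hρ : ℝ → ℂ := fun σ ↦ 1 / (((σ₁ : ℂ)) + t * I - ρ) - 1 / (((σ : ℂ)) + t * I - ρ) with hhρ
    have hcontρ : Continuous hρ := by
      have := hgz_cont ρ
      rw [hgz] at this
      -- `gz ρ = m • hρ`; continuity of `hρ` directly:
      rw [hhρ]
      refine continuous_const.sub ?_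
      refine Continuous.div continuous_const (by fun_prop) fun σ h0 ↦ ?_
      have := congrArg Complex.im h0
      simp at this
      exact hT' ρ (ZetaZeros.riemannZetaNontrivialZeros.zeta_eq_zero ρ.2) (by linarith)
    have him_int : (∫ σ in (1 / 2 : ℝ)..σ₁, gz ρ σ).im =
        (riemannZetaZeroOrder (ρ : ℂ) : ℝ) * ∫ σ in (1 / 2 : ℝ)..σ₁, (hρ σ).im := by
      have h1 : ∫ σ in (1 / 2 : ℝ)..σ₁, gz ρ σ = (riemannZetaZeroOrder (ρ : ℂ) : ℂ) * ∫ σ in (1 / 2 : ℝ)..σ₁, hρ σ := by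
        rw [← intervalIntegral.integral_const_mul]
      rw [h1]
      have h2 : (∫ σ in (1 / 2 : ℝ)..σ₁, hρ σ).im = ∫ σ in (1 / 2 : ℝ)..σ₁, (hρ σ).im := by
        have := Complex.imCLM.intervalIntegral_comp_comm (hcontρ.intervalIntegrable (μ := volume) (1 / 2) σ₁)
        simpa using this.symm
      rw [Complex.mul_im, h2]
      simp
    rw [him_int, Real.norm_eq_abs, abs_mul, abs_of_nonneg hm]
    have h3 := intervalIntegral.abs_integral_le_integral_abs (f := fun σ ↦ (hρ σ).im) (μ := volume) hσ₁h
    have h4 := integral_abs_im_le (t := t) hδ0 (ρ : ℂ) hdne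
    have h5 := perZero_bound_le (ℓ := ℓ) (t := t) hℓ0 ρ.2 hdne
    rw [← hδ] at h5
    have hX : |∫ σ in (1 / 2 : ℝ)..σ₁, (hρ σ).im| ≤ 21 * δ * SelbergSigma.wt δ t ρ := by
      refine h3.trans ?_
      simp only [hhρ]
      exact h4.trans h5
    calc (riemannZetaZeroOrder (ρ : ℂ) : ℝ) * |∫ σ in (1 / 2 : ℝ)..σ₁, (hρ σ).im|
        ≤ (riemannZetaZeroOrder (ρ : ℂ) : ℝ) * (21 * δ * SelbergSigma.wt δ t ρ) := mul_le_mul_of_nonneg_left hX hm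
      _ = 21 * δ * ((riemannZetaZeroOrder (ρ : ℂ) : ℝ) * SelbergSigma.wt δ t ρ) := by ring
  have hZfIm : |(∫ σ in (1 / 2 : ℝ)..σ₁, Zf σ).im| ≤ 21 * δ * W := by
    rw [← hImsum.tsum_eq, hW, SelbergSigma.W, ← hδ, ← Real.norm_eq_abs]
    exact tsum_of_norm_bounded (((SelbergSigma.summable_zeroOrder_mul_wt hδ0 t).hasSum.mul_left (21 * δ))) hper
  ------------------------------------------------------------------
  -- Step 5: `‖F(σ₁)‖ ≤ ‖D‖ + 4/ℓ² + (3/10) W + CJ (1 + log(1+|t|))`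
  ------------------------------------------------------------------
  have hs₁re : s₁.re = σ₁ := by
    simp only [hs₁, Complex.add_re, Complex.ofReal_re, Complex.mul_re, Complex.I_re, Complex.I_im,
      Complex.ofReal_im, mul_zero, zero_mul, sub_zero, add_zero]
  have hs₁im : s₁.im = t := by
    simp only [hs₁, Complex.add_im, Complex.ofReal_im, Complex.mul_im, Complex.I_re, Complex.I_im,
      Complex.ofReal_re, mul_zero, mul_one, zero_add, add_zero]
  have hJs₁ : ‖SelbergExplicit.remainder ℓ s₁‖ ≤ CJ * (1 + Real.log (1 + |t|)) := by
    have h := hCJb ℓ hℓ0 s₁ (by rw [hs₁re]; exact hσ₁h)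
    rw [hs₁re, hs₁im] at h
    refine h.trans ?_
    have hlog0 : 0 ≤ Real.log (1 + |t|) := Real.log_nonneg (by linarith [abs_nonneg t])
    have hX : 0 ≤ CJ * (1 + Real.log (1 + |t|)) := by positivity
    have hℓ2 : 1 ≤ ℓ ^ 2 := by nlinarith
    have he : Real.exp (-(ℓ * (σ₁ + 1 / 2))) ≤ 1 := by
      rw [Real.exp_le_one_iff]
      have := mul_nonneg hℓ0.le (show 0 ≤ σ₁ + 1 / 2 by linarith)
      linarith
    calc CJ * (1 + Real.log (1 + |t|)) * Real.exp (-(ℓ * (σ₁ + 1 / 2))) / ℓ ^ 2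
        ≤ CJ * (1 + Real.log (1 + |t|)) * Real.exp (-(ℓ * (σ₁ + 1 / 2))) := div_le_self (by positivity) hℓ2
      _ ≤ CJ * (1 + Real.log (1 + |t|)) := mul_le_of_le_one_right hX he
  have hFσ₁ : ‖Fc σ₁‖ ≤ ‖D‖ + 4 / ℓ ^ 2 + 3 / 10 * W + CJ * (1 + Real.log (1 + |t|)) := by
    have h := norm_logDeriv_add_fordK_le_of_lt (ℓ := ℓ) (t := t) (σ := σ₁) hℓ ht1 hℓt
      (by rw [← hδ]) hσ₁32
    rw [← hδ, show (σ₁ - 1 / 2 - δ) * ℓ = 0 by rw [hσ₁]; ring, neg_zero, Real.exp_zero, mul_one, ← hW] at h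
    have e : ‖Fc σ₁‖ ≤ ‖Fc σ₁ + Dc σ₁‖ + ‖Dc σ₁‖ := by
      have := norm_sub_le (Fc σ₁ + Dc σ₁) (Dc σ₁); simpa using this
    have hDc : Dc σ₁ = D := rfl
    rw [hDc] at e
    linarith
  ------------------------------------------------------------------
  -- Step 6: put the pieces together
  ------------------------------------------------------------------
  have hkey : π * zetaArgS t - M.im =
      -(δ * (Fc σ₁).im) + (∫ σ in (1 / 2 : ℝ)..σ₁, Zf σ).im - (∫ σ in (1 / 2 : ℝ)..σ₁, B σ).im -
        (∫ σ in Ioi σ₁, (Fc σ + Dc σ)).im := by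
    rw [hS, him, hsplit, hJ1, hJ23, hJ3]
    simp only [Complex.add_im, Complex.sub_im, Complex.neg_im, Complex.im_ofReal_mul]
    ring
  have hmain : |π * zetaArgS t - M.im| ≤ δ * ‖Fc σ₁‖ + 21 * δ * W +
      (4 / t + Real.log (|t| + 4) + 10) * δ + (K + 3 / 10 * W / ℓ) := by
    rw [hkey]
    have a1 : |δ * (Fc σ₁).im| ≤ δ * ‖Fc σ₁‖ := by
      rw [abs_mul, abs_of_pos hδ0]; exact mul_le_mul_of_nonneg_left (Complex.abs_im_le_norm _) hδ0.le
    have a3 : |(∫ σ in (1 / 2 : ℝ)..σ₁, B σ).im| ≤ (4 / t + Real.log (|t| + 4) + 10) * δ :=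
      (Complex.abs_im_le_norm _).trans hBnorm
    have a4 : |(∫ σ in Ioi σ₁, (Fc σ + Dc σ)).im| ≤ K + 3 / 10 * W / ℓ :=
      (Complex.abs_im_le_norm _).trans hRnorm
    calc |-(δ * (Fc σ₁).im) + (∫ σ in (1 / 2 : ℝ)..σ₁, Zf σ).im - (∫ σ in (1 / 2 : ℝ)..σ₁, B σ).im -
          (∫ σ in Ioi σ₁, (Fc σ + Dc σ)).im|
        ≤ |-(δ * (Fc σ₁).im)| + |(∫ σ in (1 / 2 : ℝ)..σ₁, Zf σ).im| + |(∫ σ in (1 / 2 : ℝ)..σ₁, B σ).im| +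
          |(∫ σ in Ioi σ₁, (Fc σ + Dc σ)).im| := by
          -- `|a + b - c - d| ≤ |a| + |b| + |c| + |d|`
          have h1 := abs_add_le (-(δ * (Fc σ₁).im) + (∫ σ in (1 / 2 : ℝ)..σ₁, Zf σ).im - (∫ σ in (1 / 2 : ℝ)..σ₁, B σ).im)
            (-(∫ σ in Ioi σ₁, (Fc σ + Dc σ)).im)
          have h2 := abs_add_le (-(δ * (Fc σ₁).im) + (∫ σ in (1 / 2 : ℝ)..σ₁, Zf σ).im) (-(∫ σ in (1 / 2 : ℝ)..σ₁, B σ).im)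
          have h3 := abs_add_le (-(δ * (Fc σ₁).im)) ((∫ σ in (1 / 2 : ℝ)..σ₁, Zf σ).im)
          simp only [abs_neg, ← sub_eq_add_neg] at h1 h2 h3 ⊢
          linarith
      _ ≤ δ * ‖Fc σ₁‖ + 21 * δ * W + (4 / t + Real.log (|t| + 4) + 10) * δ + (K + 3 / 10 * W / ℓ) := by
          rw [abs_neg] ; linarith [a1, hZfIm, a3, a4]
  ------------------------------------------------------------------
  -- Step 7: the bookkeeping of constants
  ------------------------------------------------------------------
  set L := Real.log t with hL
  set nD := ‖D‖ with hnD
  have hnD0 : 0 ≤ nD := norm_nonneg _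
  have hlog1t : Real.log (1 + |t|) ≤ 1 + L := by
    rw [abs_of_pos ht0]
    have : Real.log (1 + t) ≤ Real.log (2 * t) := Real.log_le_log (by linarith) (by linarith)
    rw [Real.log_mul (by norm_num) ht0.ne'] at this
    have hlog2 : Real.log 2 ≤ 1 := by have := Real.log_two_lt_d9; linarith
    linarith
  have hlogt4 : Real.log (|t| + 4) ≤ 1 + L := by
    rw [abs_of_pos ht0]
    have : Real.log (t + 4) ≤ Real.log (2 * t) := Real.log_le_log (by linarith) (by linarith)
    rw [Real.log_mul (by norm_num) ht0.ne'] at this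
    have hlog2 : Real.log 2 ≤ 1 := by have := Real.log_two_lt_d9; linarith
    linarith
  have h4t : 4 / t ≤ 1 := by rw [div_le_one ht0]; exact ht4
  have he3 : Real.exp 1 ≤ 3 := by have := Real.exp_one_lt_d9; linarith
  have hℓ2inv : 4 / ℓ ^ 2 ≤ δ / 8 := by
    have : (4 : ℝ) / ℓ ^ 2 = (4 / ℓ) * (1 / ℓ) := by field_simp
    rw [this]
    have h8 : 1 / ℓ ≤ 1 / 8 := one_div_le_one_div_of_le (by norm_num) hℓ
    calc 4 / ℓ * (1 / ℓ) ≤ δ * (1 / 8) := mul_le_mul h4δ h8 (by positivity) hδ0.le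
      _ = δ / 8 := by ring
  have heℓ : Real.exp (-ℓ) ≤ 1 := by rw [Real.exp_le_one_iff]; linarith
  have heℓ4 : Real.exp (-(ℓ / 4)) ≤ δ := by
    have h1 : ℓ / 4 + 1 ≤ Real.exp (ℓ / 4) := Real.add_one_le_exp _
    rw [Real.exp_neg, inv_le_comm₀ (Real.exp_pos _) hδ0]
    have h2 : δ⁻¹ ≤ ℓ / 4 := by
      rw [inv_le_comm₀ hδ0 (by positivity)]
      have : (ℓ / 4)⁻¹ = 4 / ℓ := by rw [inv_div]
      rw [this]; exact h4δ
    linarith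
  -- the pieces, each `≤ (const) δ (nD + L)`
  have hT7 : K ≤ δ * L + CJ * (δ * L) + B₀ * (δ * L) := by
    have hlog0 : 0 ≤ Real.log (1 + |t|) := Real.log_nonneg (by linarith [abs_nonneg t])
    -- `A = 4/ℓ² ≤ δ/8`
    have hA := hℓ2inv
    -- `B ≤ CJ (2+L) δ/32`
    have hinvℓ2 : 1 / ℓ ^ 2 ≤ δ / 32 := by
      have : (1 : ℝ) / ℓ ^ 2 = (4 / ℓ ^ 2) / 4 := by ring
      rw [this]; linarith
    have hB : CJ * (1 + Real.log (1 + |t|)) * Real.exp (-ℓ) / ℓ ^ 2 ≤ CJ * δ * L / 8 := by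
      have h1 : CJ * (1 + Real.log (1 + |t|)) * Real.exp (-ℓ) ≤ CJ * (2 + L) := by
        calc CJ * (1 + Real.log (1 + |t|)) * Real.exp (-ℓ) ≤ CJ * (1 + Real.log (1 + |t|)) * 1 :=
              mul_le_mul_of_nonneg_left heℓ (by positivity)
          _ ≤ CJ * (2 + L) := by
              rw [mul_one]; exact mul_le_mul_of_nonneg_left (by linarith) hCJ0.le
      have h2 : CJ * (1 + Real.log (1 + |t|)) * Real.exp (-ℓ) / ℓ ^ 2 ≤ CJ * (2 + L) * (δ / 32) := by
        rw [div_eq_mul_one_div]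
        exact mul_le_mul h1 hinvℓ2 (by positivity) (by positivity)
      have h3 : CJ * (2 + L) * (δ / 32) ≤ CJ * δ * L / 8 := by
        have := mul_le_mul_of_nonneg_left (show (2 + L) / 32 ≤ L / 8 by linarith) (mul_nonneg hCJ0.le hδ0.le)
        have e1 : CJ * (2 + L) * (δ / 32) = CJ * δ * ((2 + L) / 32) := by ring
        have e2 : CJ * δ * L / 8 = CJ * δ * (L / 8) := by ring
        rw [e1, e2]; exact this
      exact h2.trans h3
    -- `C' ≤ B₀ δ`
    have hC : B₀ * Real.exp (-(ℓ / 4)) ≤ B₀ * δ := mul_le_mul_of_nonneg_left heℓ4 hB₀0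
    have hsum : 4 / ℓ ^ 2 + CJ * (1 + Real.log (1 + |t|)) * Real.exp (-ℓ) / ℓ ^ 2 + B₀ * Real.exp (-(ℓ / 4)) ≤
        δ / 8 + CJ * δ * L / 8 + B₀ * δ := by linarith
    have hpos : 0 ≤ 4 / ℓ ^ 2 + CJ * (1 + Real.log (1 + |t|)) * Real.exp (-ℓ) / ℓ ^ 2 + B₀ * Real.exp (-(ℓ / 4)) := by
      positivity
    rw [hK]
    have h3 : Real.exp 1 * (4 / ℓ ^ 2 + CJ * (1 + Real.log (1 + |t|)) * Real.exp (-ℓ) / ℓ ^ 2 +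
        B₀ * Real.exp (-(ℓ / 4))) ≤ 3 * (δ / 8 + CJ * δ * L / 8 + B₀ * δ) :=
      mul_le_mul he3 hsum hpos (by norm_num)
    have h4 : 3 * (B₀ * δ) ≤ B₀ * (δ * L) := by
      have := mul_le_mul_of_nonneg_left (show (3 : ℝ) ≤ L by linarith) (mul_nonneg hB₀0 hδ0.le)
      linarith [show B₀ * δ * L = B₀ * (δ * L) by ring, show B₀ * δ * 3 = 3 * (B₀ * δ) by ring]
    have h5 : 3 * (δ / 8) ≤ δ * L := by nlinarith
    have h6 : 3 * (CJ * δ * L / 8) ≤ CJ * (δ * L) := by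
      have : 0 ≤ CJ * (δ * L) := by positivity
      linarith [show CJ * δ * L = CJ * (δ * L) by ring]
    linarith
  have hT8 : 3 / 10 * W / ℓ ≤ 3 / 40 * (δ * W) := by
    have : 3 / 10 * W / ℓ = 3 / 10 * W * (1 / ℓ) := by ring
    rw [this]
    nlinarith [mul_le_mul_of_nonneg_left hℓδ (show 0 ≤ 3 / 10 * W by positivity)]
  have hδW : δ * W ≤ 6 * (δ * nD) + CW * (δ * L) := by
    have := mul_le_mul_of_nonneg_left hWle hδ0.le
    have e : δ * (6 * nD + CW * L) = 6 * (δ * nD) + CW * (δ * L) := by ring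
    linarith
  have hT6 : (4 / t + Real.log (|t| + 4) + 10) * δ ≤ 4 * (δ * L) := by
    have hs : 4 / t + Real.log (|t| + 4) + 10 ≤ 4 * L := by linarith
    have := mul_le_mul_of_nonneg_right hs hδ0.le
    linarith [show 4 * L * δ = 4 * (δ * L) by ring]
  have hT24 : δ * ‖Fc σ₁‖ ≤ δ * nD + δ * L / 4 + 3 / 10 * (δ * W) + 2 * CJ * (δ * L) := by
    have h0 := mul_le_mul_of_nonneg_left hFσ₁ hδ0.le
    have h64 : 4 / ℓ ^ 2 ≤ L / 4 := by
      have : 4 / ℓ ^ 2 ≤ 1 := by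
        rw [div_le_one (by positivity)]; nlinarith
      linarith
    have q := mul_le_mul_of_nonneg_left h64 hδ0.le
    have hl2 : 1 + Real.log (1 + |t|) ≤ 2 * L := by linarith
    have q2 := mul_le_mul_of_nonneg_left hl2 (mul_nonneg hδ0.le hCJ0.le)
    have e1 : δ * (nD + 4 / ℓ ^ 2 + 3 / 10 * W + CJ * (1 + Real.log (1 + |t|))) =
        δ * nD + δ * (4 / ℓ ^ 2) + 3 / 10 * (δ * W) + δ * CJ * (1 + Real.log (1 + |t|)) := by ring
    have e2 : δ * (L / 4) = δ * L / 4 := by ring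
    have e3 : δ * CJ * (2 * L) = 2 * CJ * (δ * L) := by ring
    rw [hnD] at h0 ⊢
    linarith
  -- conclusion
  have hδL0 : 0 ≤ δ * L := by positivity
  have hδD0 : 0 ≤ δ * nD := by positivity
  calc |π * zetaArgS t - M.im|
      ≤ δ * ‖Fc σ₁‖ + 21 * δ * W + (4 / t + Real.log (|t| + 4) + 10) * δ + (K + 3 / 10 * W / ℓ) := hmain
    _ ≤ (δ * nD + δ * L / 4 + 3 / 10 * (δ * W) + 2 * CJ * (δ * L)) + 21 * (δ * W) + 4 * (δ * L) +
          ((δ * L + CJ * (δ * L) + B₀ * (δ * L)) + 3 / 40 * (δ * W)) := by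
        have : 21 * δ * W = 21 * (δ * W) := by ring
        linarith
    _ ≤ (200 + 3 * CJ + B₀ + 22 * CW) * δ * (nD + L) := by
        have e : (200 + 3 * CJ + B₀ + 22 * CW) * δ * (nD + L) =
            200 * (δ * nD) + 200 * (δ * L) + 3 * (CJ * (δ * nD)) + 3 * (CJ * (δ * L)) +
              (B₀ * (δ * nD)) + (B₀ * (δ * L)) + 22 * (CW * (δ * nD)) + 22 * (CW * (δ * L)) := by ring
        rw [e]
        have p1 := mul_nonneg hCJ0.le hδD0
        have p2 := mul_nonneg hB₀0 hδD0
        have p3 := mul_nonneg hCW0.le hδD0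
        have p4 := mul_nonneg hCJ0.le hδL0
        have p5 := mul_nonneg hB₀0 hδL0
        have p6 := mul_nonneg hCW0.le hδL0
        linarith

end SelbergApprox

end Literature.NumberTheory.LFunctions
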